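import Literature.MathematicalPhysics.QuantumFieldTheory.Balaban1983to89.B6Geom246MultiLevelTorus
import Literature.MathematicalPhysics.QuantumFieldTheory.Balaban1983to89.B8Ineq192MultiLevelBox

/-!
# `Balaban1983to89.B8Ineq192MultiLevelTorus` — T. Bałaban, *Spaces of regular gauge field configurations on a lattice and gauge
# fixing conditions*, Commun. Math. Phys. **99** (1985) 75–102 [Balaban1985RegularSpaces], **(1.91)–(1.92)** p. 91
# «|(H′X)(x)|, |(∇H′X)(x)| ≦ B′₀[1, (Lʲη)⁻¹]|X| for x ∈ Ω_j», the Δ-entry consumed on p. 93, «Q′H′ = I» (p. 96) and p. 92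
# «|Rf| ≦ B′₀|f|», for H′ = G′²Q′\*(Q′G′²Q′\*)⁻¹ and R = I − G′Q′\*(Q′G′²Q′\*)⁻¹Q′G′ **AT THE FLAT BACKGROUND U₀ = 1 ON PRINT'S OWN
# CARRIER: THE TORUS `T_η` WITH A GENUINE NESTED SEQUENCE OF DOMAINS `T_η = Ω₁ ⊃ Ω₂ ⊃ … ⊃ Ω_k`** (the `k`-level torus family
# `TDomains` of [B6] §2, p. 224 «we admit the case when some domains Ω_j are equal to T_η»), the [B6] Prop. 2.2 majorants of
# `G′`, `∇G′`, `ΔG′` and the inverse `(Q′G′²Q′\*)⁻¹` entering BY THEIR PRINTED PROPERTIES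

statement-level skeleton of published theorems with citation tags; proofs where landed; nothing here is a claim about the Yang–Mills mass gap

PDF held: `paper:balaban1985-cmp99-regular-spaces-gauge-fixing` (journal page = PDF page + 74); text layer of p. 91 [PDF 17]
l. 30–34 ((1.91), (1.92) «for x ∈ Ω_j»), p. 92 [PDF 18] l. 2–4 (the display of `(H′X)(x)`, «B′₀ is an absolute constant
(depending on d and L only)», «from Theorems 3.1, 3.2 of [4] it follows that |Rf| ≦ B′₀|f|»), p. 93 [PDF 19] l. 4 («… and with
ΔH′D′(u₁, λ)»), p. 96 [PDF 22] ((1.115) ⇒ (1.116): Q′H′ = I) re-read by this seat's lineage (gens 43–45, module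
`B8Ineq192MultiLevelBox`); [B6] p. 224 [PDF 2] «We consider a sequence of domains Ω₁ ⊃ Ω₂ ⊃ … ⊃ Ω_k, Ω_j ⊂ T_η, j = 1, 2, …, k
(2.1)» … «Let us notice that we admit the case when some domains Ω_j are equal to T_η» (text layer
`paper:balaban1984-cmp96-propagators-rt-ii` p0002 l. 2–4, 17; v1.1 docfix S-B8-g55-1 of referee ref-4 «Gen 55»: the v1.0 line put a
paraphrase inside the quotation marks — statements unaffected).

CITATION HEADER (lean-in-tree rule).  Cell `lit-balaban` (HOME `run/shared/lean/pub/lit-balaban/`), unit `lit-balaban-r05` gen 54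
(B8 reader/typer and fold owner; free-target protocol G.5-34(d), TAKING HOME/STATUS 2026-08-22T21:32Z, successor trigger (iii-b)
of the seat's HANDOFF § gen 52/53).  WHAT IS REPRODUCED = SKELETON row **B8.Eq1.91** ((1.91)–(1.92)), member (1.92), the p. 93
Δ-entry, «Q′H′ = I» and row **B8.Claim@92** («|Rf| ≦ B′₀|f|»), on THE PRINTED CARRIER at the flat background: after the
Neumann-box instance `B8Ineq192MultiLevelBox` (this seat, gen 43: an arbitrary nested family of block-union domains of a
Neumann BOX) this module proves the same bounds, WITH THEIR LEVEL PREFACTORS, for the GENUINE `k`-level operator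
`G′ = Δ′_a⁻¹ = B6MultiLevelTorusOperator.gmlT` of seat p21's TORUS carrier (CMP 96 §2 on `T_η`, `Ω₁ = T_η` admitted: the
fundamental box `↥(boxDom N₀)` with the PERIODIC Laplacian `perLapT`, nested family `D : TDomains d ℓ M_h k P R` with (2.1) and
the torus form of (2.2)), `Q′\* = B6Ineq268MultiLevelBox.QsB D.toDomains` (the (2.69)-adjoint of the normalised block average
`Q′ = QB D.toDomains`; block data are Laplacian-free and apply verbatim), the multiscale distance (2.46) OF THE TORUS
(`B6Geom246MultiLevelTorus.geomT`, Lemma 2.1 on the torus `lemma21_torus`, p21 T3 p341342).  TWO KINDS OF ANALYTIC INPUT ENTER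
AS ARGUMENTS (the device of `B8Ineq192MultiLevelBox` / `B8Ineq198R.ineq198_R_of_thms3132`; D-0026: hypotheses of theorems, no
`… : Prop` fact minted): (a) the three [B6] Prop. 2.2 majorants of `G′`, `∂_μG′`, `(−Δ_T)G′` ON THE TORUS GEOMETRY — first,
second and sixth entries of (2.67), exactly the three entries the box file consumes (`obtain ⟨hTG, hTD, -, hTL⟩`) — in the
`HasMajorant` shapes that p21's torus files print for this very family (`B6Prop22MultiLevelTorus.prop22_first_multiLevelTorus`,
`B6Prop22DerivMultiLevelTorus.prop22_second_multiLevelTorus`, `B6Prop22LapMultiLevelTorus.prop22_sixth_multiLevelTorus`: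
the first filed as p342287 while this file was written, the other two kernel-checked and staged READY in
`lit-balaban-p21/lean/`; the difference operators `∂_μ` and the Laplacian enter as ARBITRARY fine-lattice matrices `Dd μ`, `Lap`
carrying those majorants — p21's periodic forward differences `dT N₀ μ` and `perLapT N₀ = −Δ_T` (T1) are the intended instances);
(b) the inverse `(Q′G′²Q′\*)⁻¹` of (1.91) as an operator `G` on `𝔅` with the two conclusions [B6] Prop. 2.3 prints for it: the
inverse identity `(Q′G′²Q′\*)·G = 1` (`kerOp (W D.toDomains) (XkT D a) * G = 1`) and the kernel bound (2.87)
`|G(y, y′)| ≦ C₁(Lʲη)⁻⁴(L^{j′}η)^{−(d+1)}e^{−½δ₁d_T(y,y′)}`.  When p21's three entry files are in the tree a short corollary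
discharges (a) by name (successor note in HOME/lit-balaban-r05/HANDOFF.md § gen 54), exactly as `B8Ineq192MultiLevelBoxP23`
discharged the box file's (b).  Kind «kernel-checked proof of a model instance»; definitions with bodies (`geomTB`, `csysTB`,
`XkT`, `hPrimeMLT` = (1.91), `hKerT`, `rProjMLT` = [4] (3.25) on these carriers); every input enters BY NAME; 0 sorry.

WHAT IS PRINTED (verbatim).  p. 91 [PDF 17]: *"Let us introduce the operators H′ = G′²Q′\*(Q′G′²Q′\*)⁻¹, G′ = (Δ + Q′\*aQ′)⁻¹.
(1.91) They were investigated in [4], and the following inequality can be obtained from the results of this paper: |(H′X)(x)|,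
|(∇H′X)(x)| ≦ B′₀[1, (Lʲη)⁻¹]|X| for x ∈ Ω_j, (1.92)"*; p. 92 [PDF 18]: *"where (H′X)(x) = Σ_{y′∈𝔅_k}(L^{j′}η)^d H′(x, y′)X(y′),
and B′₀ is an absolute constant (depending on d and L only)."*, *"from Theorems 3.1, 3.2 of [4] it follows that |Rf| ≦ B′₀|f|"*;
p. 93 [PDF 19] l. 1–4: *"… and with ΔH′D′(u₁, λ)."*; p. 96 [PDF 22], (1.115) ⇒ (1.116): the identity «Q′H′ = I».  [B6] = T. Bałaban,
*Propagators and renormalization transformations for lattice gauge theories. II*, CMP **96** (1984) 223–250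
[Balaban1984PropagatorsII]: p. 224 «we admit the case when some domains Ω_j are equal to T_η»; p. 235 [PDF 13] *"Of course the
operator Q′G′²Q′\* is positive definite, so its inverse is well defined"*; Prop. 2.2 (2.67) p. 234, Prop. 2.3 (2.87) p. 238, Lemma 2.1
(2.60)–(2.61) p. 234, the composition rule (2.52)–(2.55) p. 232 and the scale sum (2.68) p. 235.

WHAT THIS FILE PROVES (kernel; axioms standard).  Setting of `B6MultiLevelTorusOperator` / `B6Geom246MultiLevelTorus`: the torus
`T_η = ↥(boxDom N₀)`, `N₀ = L^k·L·M_h·P` in lattice units (η = 1, spatial dimension `d + 1`, `L = ℓ + 1`), nested family `D : TDomains`,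
blocks `𝔅 = bset D.toDomains`, block map `y(x) = blkOf D.toDomains x`, lengths `(geomT D).len y = Lʲ` for `y ∈ Λ_j`, torus multiscale
distance `d_T = (geomT D).dist` (2.46).
* §0 **`geomTB D`** := `geomT D` with print's `M := L·M_h`, `R := R − 1/(L·M_h)` (so `R·M = R·L·M_h − 1`, the walk constant of
  `levelGapT`) — the torus twin of `B6Ineq268MultiLevelBox.geomB`; `levelSepTB` ((2.60) in the metric form `LevelSep` ON THE TORUS,
  from `levelGapT` through `B6Geometry.ineq260_of_levelGap`), `triangleTB`/`symmTB`/`refl_nonnegTB`.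
* §1 **`hPrimeMLT D a G`** := G′∘G′∘Q′\*∘G with `G′ = gmlT` — (1.91) with bodies; **`XkT`** (the (2.69)-kernel of `Q′G′²Q′\*` on the
  torus, `kerOp_XkT`); **`QB_comp_hPrimeMLT`: Q′H′ = 1** from `(Q′G′²Q′\*)G = 1`; the kernel **`hKerT`** with p. 92's display
  **`hPrimeMLT_eq_sum`**.
* §2 torus lengths and THE SCALE ABSORPTION (2.60) on the torus (`inv_pow_lenT_le`, `pow_lenT_le`, via the abstract engine of
  `B8Ineq192MultiLevelBox` §2 BY NAME on `geomTB D`); **`hasMajorant_compT`** — the composite majorant with `G′` ((2.68) for a pair,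
  middle point by (2.61) = `lemma21_torus`).
* §3 **`hPrime_single_decay_T`** — THE KERNEL OF (1.91) ON THE TORUS DECAYS WITH THE LEVEL PREFACTORS `[1, (Lʲ)⁻¹, (Lʲ)⁻²]`: for all
  `C, δ₀, C₁, δ₁ > 0` there are `ρ, B > 0`, `N₁ ≥ 1` (functions of `d, ℓ, C, δ₀, C₁, δ₁`) such that for every `k`, `M_h ≥ 1`, `R` with
  `R·L·M_h ≥ N₁ + 1`, every torus size `P`, every nested torus family `D`, every weight sequence `a`, every family `Dd μ` of fine
  matrices and every fine matrix `Lap`, IF `G′ = gmlT` has the first-entry majorant `C·L^{2j}e^{−½δ₀d_T}`, each `Dd μ·G′` the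
  second-entry majorant `C·Lʲe^{−½δ₀d_T}` and `Lap·G′` the sixth-entry majorant `Ce^{−½δ₀d_T}`, then for EVERY `G` with the
  (2.87)-bound: `|(H′δ_{y′})(x)| ≦ Be^{−ρd_T}`, `|(Dd μ·H′δ_{y′})(x)| ≦ B(Lʲ)⁻¹e^{−ρd_T}`, `|(Lap·H′δ_{y′})(x)| ≦ B(Lʲ)⁻²e^{−ρd_T}`
  (`j = D.lev x`); `hKer_decay_T` (the (2.69)-kernel, first entry only).
* §4 **`ineq192_multiLevelTorus`** — **(1.92) + THE p. 93 Δ-ENTRY AT U₀ = 1 ON THE `k`-LEVEL TORUS FAMILY** under the same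
  hypotheses: `|(H′X)(x)| ≦ B′₀S`, `|(Dd μ·H′X)(x)| ≦ B′₀(Lʲ)⁻¹S`, `|(Lap·H′X)(x)| ≦ B′₀(Lʲ)⁻²S` for `|X| ≦ S`;
  `ineq192_multiLevelTorus_supNorm`; `QB_hPrimeMLT` (Q′(H′X) = X).
* §5 **`rProjMLT D a G`** := 1 − G′Q′\*·G·Q′G′ ([4] (3.25), B8's `R(U₀)` (1.27) at U₀ = 1) on the torus; `QB_gmlT_rProjMLT` (Q′G′R = 0),
  `rProjMLT_gmlT_QsB` (R·G′Q′\* = 0), `rProjMLT_idem` (R² = R); **`rProjMLT_sup_bound`** — p. 92 «|Rf| ≦ B′₀|f|» AT U₀ = 1 ON THE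
  `k`-LEVEL TORUS FAMILY under the first-entry majorant and the (2.87)-bound.

HONEST SCOPE / NOT CLAIMED.  (i) Neither `G′`'s Prop.-2.2 majorants nor `(Q′G′²Q′\*)⁻¹` are constructed here: they are ARGUMENTS
constrained by the printed shapes; the theorems are CONDITIONAL on inhabitants — the three majorants are supplied for this very
family by p21's torus Prop. 2.2 files (the first filed as p342287 while this file was written, the second and sixth staged READY:
hence no `M_h ≥ 3`, «M large», `P_μ ≥ 4` or weight-window hypothesis appears here — those belong to Prop. 2.2 itself and enter the
discharging corollary), the inverse by a torus Prop. 2.3 not yet begun; until then the value is the algebra-and-random-walk half of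
(1.91)–(1.92) on print's carrier (cell interface IF-A-01 at U₀ = 1, B8-CLOSURE §3.1(a) moved from the Neumann box to `T_η`).  (ii) Levels `1 … k` with `Ω₁ = T_η`, `A = 0` (U₀ = 1), scalar fibre,
lattice units (`Lʲ` for «Lʲη»), `m² = 0`, exactly the scope of p21's torus chain; `x ∈ Ω_j` is read at the point's own level
`j = D.lev x`; `|X|` = the sup norm over `𝔅`; `∂_μ` = any family `Dd μ` with the second-entry majorant (p21's periodic forward
difference `dT` the intended one), `−Δ_T = perLapT` (T1).  (iii) Constants existential and crude (functions of `d, ℓ, C, δ₀, C₁,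
δ₁`; print: «depending on d and L only»); the (2.61) constant is the `L`-dependent `K261` (GAPS G-A11-1); «RM sufficiently large» is
the explicit threshold `N₁`.  (iv) The general (1.92) — a background `U₀ ∈ 𝔄_k` with (3.35) of [4] — stays the typed leaf of
`B8Ineq192` / `B8Ineq192Op`; rows B8.Eq1.91 / B8.Claim@92: heads NOT changed by this file (owner's word: model instance).
(v) NOT summit progress, NOT continuum, NOT Clay.

RELATED IN THE TREE, NOT DUPLICATED (stem check 2026-08-22T21:31Z: `ls Balaban1983to89 | grep -i '192\|MultiLevelTorus'` =
`B15Claim192Flow`, `B6Eq238MultiLevelTorus`, `B6Geom246MultiLevelTorus`, `B6MultiLevelTorusOperator`, `B8Ineq192`,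
`B8Ineq192FlatTorus` (ONE scale, constant domain sequence, hypothesis-free), `B8Ineq192GaugeInv`, `B8Ineq192MultiLevelBox[P23]`
(the Neumann-box twin, whose abstract §2 engine is used BY NAME), `B8Ineq192Op`; no multi-level torus instance).
-/

namespace Literature.MathematicalPhysics.QuantumFieldTheory.Balaban1983to89.B8Ineq192MultiLevelTorus

open Finset Matrix
open B4Reflection242 (boxDom)
open B6MultiLevelBoxOperator
open B6MultiLevelTorusOperator
open B6Geom246MultiLevelBox
open B6Geom246MultiLevelTorus
open B6Ineq268MultiLevelBox
open B6RandomWalk (HasMajorant BlockSupp Triangle254 hasMajorant_mul hasMajorant_mono blockPiece sum_blockPiece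
  blockSupp_blockPiece)
open B6Ineq268 (LevelSep Symm mx mx_eq_of_lt' dist_nonneg_of_levelSep)
open B6Lemma21Repaired (Ineq261With)
open B6Ineq261LevelGap (K261 K261_nonneg theta_lt_one_of_log)
open B6Expansion282 (kerOp)
open B6Ineq2142 (kernelW kerOp_kernelW)
open B6Prop23Chain (mat apply_eq_sum_mat)
open B6Geometry (ContourSystem Realizes dist_comm_of_realizes triangle254_of_realizes ineq260_of_levelGap)
open B8Ineq192MultiLevelBox (abs_apply_le_of_levelBound pow_len_le_of_levelSep ineq261With_of_le levelConv_le
  levelRowSum_le abs_sum_mul_le_of_decay)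

noncomputable section

variable {d : ℕ}

/-! ## §0  The geometry of the chain on the torus: `geomT` with print's `R`, `M`; (2.60) in metric form -/

section GeometryTB

variable {ℓ Mh k R : ℕ} {P : Fin (d + 1) → ℕ} (D : TDomains d ℓ Mh k P R)

/-- **THE GEOMETRY OF THE CHAIN ON THE TORUS**: `geomT D` (sites `𝔅`, `d_T` = (2.46) realised as the bond-graph distance of the
torus, scale = level, `L`, `η = 1`) with print's `M := L·M_h` and `R := R − 1/(L·M_h)`, so that `R·M = R·L·M_h − 1` is the walk
constant with which `levelGapT` certifies (2.60) on the torus — the twin of `B6Ineq268MultiLevelBox.geomB`.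
[cite: Balaban1984PropagatorsII, (2.1)–(2.2) p.224, (2.45)–(2.46) p.231, (2.60) p.234] -/
def geomTB : B6.Geometry :=
  { geomT D with
    R := (R : ℝ) - 1 / (((ℓ : ℝ) + 1) * Mh)
    M := ((ℓ : ℝ) + 1) * Mh }

/-- `geomTB` has the sites of `geomT` (the blocks `𝔅`). [cite: Balaban1984PropagatorsII, (2.45) p.231, dictionary] -/
@[simp] theorem geomTB_Site : (geomTB D).Site = ↥(bset D.toDomains) := rfl

/-- the sites of `geomTB` have decidable equality. [cite: Balaban1984PropagatorsII, (2.45) p.231, dictionary] -/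
instance instDecidableEqGeomTBSite : DecidableEq (geomTB D).Site := inferInstanceAs (DecidableEq ↥(bset D.toDomains))

/-- … the distance of `geomT` (the torus (2.46)). [cite: Balaban1984PropagatorsII, (2.46) p.231, dictionary] -/
theorem geomTB_dist : (geomTB D).dist = (geomT D).dist := rfl
/-- … the lengths `Lʲη = Lʲ`. [cite: Balaban1984PropagatorsII, (2.1) p.224, dictionary] -/
theorem geomTB_len (y : ↥(bset D.toDomains)) : (geomTB D).len y = ((ℓ : ℝ) + 1) ^ y.1.1 * 1 := rfl
/-- the lengths of `geomT`: `Lʲη = Lʲ`. [cite: Balaban1984PropagatorsII, (2.1) p.224, dictionary] -/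
theorem geomT_len (y : ↥(bset D.toDomains)) : (geomT D).len y = ((ℓ : ℝ) + 1) ^ y.1.1 * 1 := rfl
/-- … `L`. [cite: Balaban1984PropagatorsII, (2.1) p.224, dictionary] -/
theorem geomTB_L : (geomTB D).L = (ℓ : ℝ) + 1 := rfl
/-- … `η = 1`. [cite: Balaban1984PropagatorsII, (2.1) p.224, dictionary] -/
theorem geomTB_eta : (geomTB D).eta = 1 := rfl
/-- … `M = L·M_h`. [cite: Balaban1984PropagatorsII, (2.2) p.224 («M is a size of big blocks»), dictionary] -/
theorem geomTB_M : (geomTB D).M = ((ℓ : ℝ) + 1) * Mh := rfl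
/-- … `R = R − 1/(L·M_h)`. [cite: Balaban1984PropagatorsII, (2.2) p.224, (2.60) p.234, dictionary] -/
theorem geomTB_R : (geomTB D).R = (R : ℝ) - 1 / (((ℓ : ℝ) + 1) * Mh) := rfl

/-- **`R·M = R·L·M_h − 1`** (the walk constant of `levelGapT`). [cite: Balaban1984PropagatorsII, (2.60) p.234, (2.2) p.224] -/
theorem geomTB_RM (hMh : 1 ≤ Mh) : (geomTB D).R * (geomTB D).M = (R : ℝ) * (((ℓ : ℝ) + 1) * Mh) - 1 := by
  rw [geomTB_R, geomTB_M]
  have hM : (((ℓ : ℝ) + 1) * Mh) ≠ 0 := by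
    have : (1 : ℝ) ≤ Mh := by exact_mod_cast hMh
    positivity
  field_simp

/-- `R·M ≥ 0` once `R·L·M_h ≥ 1`. [cite: Balaban1984PropagatorsII, (2.2) p.224, dictionary] -/
theorem geomTB_RM_nonneg (hMh : 1 ≤ Mh) (hRM : 1 ≤ R * ((ℓ + 1) * Mh)) : 0 ≤ (geomTB D).R * (geomTB D).M := by
  rw [geomTB_RM D hMh]
  have : (1 : ℝ) ≤ (R : ℝ) * (((ℓ : ℝ) + 1) * Mh) := by exact_mod_cast hRM
  linarith

/-- the contour system realising `geomTB`: lattice points = the blocks, bonds = the admissible bonds `bondT D` of the torus.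
[cite: Balaban1984PropagatorsII, (2.46) p.231] -/
def csysTB : ContourSystem (geomTB D) := ⟨↥(bset D.toDomains), bondT D, id, fun s => s.1.1, fun _ => rfl⟩

/-- `geomTB` is realised by `csysTB` ((2.46) on the torus holds by definition). [cite: Balaban1984PropagatorsII, (2.46) p.231] -/
theorem realizesTB : Realizes (geomTB D) (csysTB D) := fun _ _ => rfl

/-- **(2.54)** for `geomTB`. [cite: Balaban1984PropagatorsII, (2.54) p.233] -/
theorem triangleTB (hMh : 1 ≤ Mh) (hP : ∀ μ, 1 ≤ P μ) : Triangle254 (geomTB D) :=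
  triangle254_of_realizes (realizesTB D) (connectedT hMh hP)

/-- symmetry of the torus distance. [cite: Balaban1984PropagatorsII, (2.46) p.231] -/
theorem symmTB : Symm (geomTB D) := fun y y' => dist_comm_of_realizes (realizesTB D) y y'

/-- symmetry of `d_T` for `geomT`. [cite: Balaban1984PropagatorsII, (2.46) p.231] -/
theorem symmT (y y' : ↥(bset D.toDomains)) : (geomT D).dist y y' = (geomT D).dist y' y := symmTB D y y'

/-- **(2.60) IN THE METRIC FORM `LevelSep` ON THE TORUS**: `(R·L·M_h − 1)·max{|j − j′| − 1, 0} ≤ d_T(y, y′)`, from the walk form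
of the torus (2.2) (`levelGapT`) through `B6Geometry.ineq260_of_levelGap` — the route of `B6Ineq268MultiLevelBox.levelSepB`.
[cite: Balaban1984PropagatorsII, (2.60) p.234, (2.2) p.224, (2.57) p.233] -/
theorem levelSepTB (hMh : 1 ≤ Mh) (hP : ∀ μ, 1 ≤ P μ) (hRM : 1 ≤ R * ((ℓ + 1) * Mh)) : LevelSep (geomTB D) := by
  have h1 : (0 : ℝ) < 1 * 1 := by norm_num
  refine (B6Ineq268.levelSep_iff_ineq260 (g := geomTB D) h1).mpr ?_
  refine ineq260_of_levelGap (realizesTB D) (connectedT hMh hP) (levelGapT D) ?_ h1.le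
  show (geomTB D).R * (geomTB D).M ≤ ((R * ((ℓ + 1) * Mh) - 1 : ℕ) : ℝ)
  rw [geomTB_RM D hMh, Nat.cast_sub hRM]
  push_cast
  exact le_rfl

/-- `Lʲ > 0` on the torus geometry. [cite: Balaban1984PropagatorsII, (2.1) p.224, dictionary] -/
theorem lenT_pos (y : ↥(bset D.toDomains)) : 0 < (geomT D).len y := by
  rw [geomT_len, mul_one]; positivity

/-- `Lʲη = Lʲ` with `j` the level of the block. [cite: Balaban1984PropagatorsII, (2.1) p.224, dictionary] -/
theorem lenT_eq (y : ↥(bset D.toDomains)) : (geomT D).len y = ((ℓ : ℝ) + 1) ^ y.1.1 := by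
  rw [geomT_len, mul_one]

/-- the length at the block of a site: `L^{lev x}`. [cite: Balaban1984PropagatorsII, p.231 («x ∈ B^j(y)»), dictionary] -/
theorem lenT_blkOf (x : ↥(boxDom (N0 ℓ Mh k P))) :
    (geomT D).len (blkOf D.toDomains x) = ((ℓ : ℝ) + 1) ^ D.lev x.1 := by
  rw [lenT_eq]; rfl

/-- the (2.69) weight is `W(y′) = (L^{j′})^{d+1}` = the `(d+1)`-st power of the torus length (block data are Laplacian-free).
[cite: Balaban1984PropagatorsII, (2.69) p.235, dictionary] -/
theorem W_eq_lenT_pow (y : ↥(bset D.toDomains)) : W D.toDomains y = (geomT D).len y ^ (d + 1) := by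
  rw [W_eq, lenT_eq]

end GeometryTB

/-! ## §1  (1.91) on the `k`-level torus family: `H′ = G′²Q′*·G`, `G` standing for `(Q′G′²Q′*)⁻¹`; «Q′H′ = I»; the kernel -/

section HPrime

variable {ℓ Mh k R : ℕ} {P : Fin (d + 1) → ℕ} (D : TDomains d ℓ Mh k P R) (a : ℕ → ℝ)

/-- **THE (2.69)-KERNEL `X(y, y′)` OF `Q′G′²Q′*` ON THE TORUS** for the genuine `k`-level `G′ = gmlT`:
`X = kernelW W (Q′∘G′∘G′∘Q′*)` (`kerOp_XkT`) — the torus twin of `B6Ineq268MultiLevelBox.Xk`.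
[cite: Balaban1984PropagatorsII, (2.68)–(2.69) p.235] -/
def XkT : ↥(bset D.toDomains) → ↥(bset D.toDomains) → ℝ :=
  kernelW (W D.toDomains) (QB D.toDomains ∘ₗ Matrix.toLin' (gmlT (N0 ℓ Mh k P) ℓ k D.lev a) ∘ₗ
    Matrix.toLin' (gmlT (N0 ℓ Mh k P) ℓ k D.lev a) ∘ₗ QsB D.toDomains)

/-- the operator with (2.69)-kernel `XkT` IS `Q′G′²Q′*`. [cite: Balaban1984PropagatorsII, (2.69) p.235] -/
theorem kerOp_XkT :
    kerOp (W D.toDomains) (XkT D a) = QB D.toDomains ∘ₗ Matrix.toLin' (gmlT (N0 ℓ Mh k P) ℓ k D.lev a) ∘ₗ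
      Matrix.toLin' (gmlT (N0 ℓ Mh k P) ℓ k D.lev a) ∘ₗ QsB D.toDomains :=
  kerOp_kernelW (fun y => (W_pos D.toDomains y).ne') _

/-- **(1.91) at U₀ = 1 on the `k`-level TORUS family**: `H′ = G′·G′·Q′*·G : (𝔅 → ℝ) →ₗ (T_η → ℝ)` with the GENUINE
`G′ = Δ′_a⁻¹ = gmlT` (the `k`-level operator (2.13)–(2.14) of [B6] on the torus, inverted), `Q′* = QsB` (the (2.69)-adjoint of the
normalised block average), and `G` an operator on `𝔅` standing for `(Q′G′²Q′*)⁻¹` («positive definite, so its inverse is well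
defined»). [cite: Balaban1985RegularSpaces, (1.91) p.91; Balaban1984PropagatorsII, p.235, p.224 (Ω₁ = T_η admitted)] -/
def hPrimeMLT (G : Module.End ℝ (↥(bset D.toDomains) → ℝ)) :
    (↥(bset D.toDomains) → ℝ) →ₗ[ℝ] (↥(boxDom (N0 ℓ Mh k P)) → ℝ) :=
  Matrix.toLin' (gmlT (N0 ℓ Mh k P) ℓ k D.lev a) ∘ₗ Matrix.toLin' (gmlT (N0 ℓ Mh k P) ℓ k D.lev a) ∘ₗ
    QsB D.toDomains ∘ₗ G

/-- **The (2.69)-kernel of (1.91) on the torus**: `H′(x, y′) = (H′δ_{y′})(x)/(L^{j′}η)^{d+1}`, so that p. 92's display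
`(H′X)(x) = Σ_{y′∈𝔅}(L^{j′}η)^{d+1}H′(x, y′)X(y′)` holds (`hPrimeMLT_eq_sum`). [cite: Balaban1985RegularSpaces, p.92 (the display after (1.92)); Balaban1984PropagatorsII, (2.69) p.235] -/
def hKerT (G : Module.End ℝ (↥(bset D.toDomains) → ℝ)) (x : ↥(boxDom (N0 ℓ Mh k P))) (y' : ↥(bset D.toDomains)) : ℝ :=
  hPrimeMLT D a G (Pi.single y' 1) x / W D.toDomains y'

variable {D a}

/-- the letters of (1.91) applied in turn: `H′X = G′(G′(Q′*(GX)))`. [cite: Balaban1985RegularSpaces, (1.91) p.91] -/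
theorem hPrimeMLT_apply (G : Module.End ℝ (↥(bset D.toDomains) → ℝ)) (X : ↥(bset D.toDomains) → ℝ) :
    hPrimeMLT D a G X =
      gmlT (N0 ℓ Mh k P) ℓ k D.lev a *ᵥ (gmlT (N0 ℓ Mh k P) ℓ k D.lev a *ᵥ QsB D.toDomains (G X)) := by
  simp only [hPrimeMLT, LinearMap.comp_apply, Matrix.toLin'_apply]

/-- **«Q′H′ = I»** (p. 96, the step (1.115) ⇒ (1.116)) on the torus: if `G` inverts `Q′G′²Q′*` on the right —
`(Q′G′²Q′*)·G = 1` (`kerOp (W D.toDomains) (XkT D a)` IS `Q′G′²Q′*`, `kerOp_XkT`) — then `Q′ ∘ H′ = id` on `𝔅 → ℝ`.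
[cite: Balaban1985RegularSpaces, (1.115)–(1.116) p.96; Balaban1984PropagatorsII, p.235] -/
theorem QB_comp_hPrimeMLT {G : Module.End ℝ (↥(bset D.toDomains) → ℝ)} (hG : kerOp (W D.toDomains) (XkT D a) * G = 1) :
    QB D.toDomains ∘ₗ hPrimeMLT D a G = LinearMap.id := by
  rw [kerOp_XkT, Module.End.mul_eq_comp, Module.End.one_eq_id] at hG
  simpa only [hPrimeMLT, LinearMap.comp_assoc] using hG

/-- hence `Q′(H′X) = X` for every coarse function `X`. [cite: Balaban1985RegularSpaces, (1.115)–(1.116) p.96] -/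
theorem QB_hPrimeMLT {G : Module.End ℝ (↥(bset D.toDomains) → ℝ)} (hG : kerOp (W D.toDomains) (XkT D a) * G = 1)
    (X : ↥(bset D.toDomains) → ℝ) : QB D.toDomains (hPrimeMLT D a G X) = X := by
  have h := congrArg (fun T : (↥(bset D.toDomains) → ℝ) →ₗ[ℝ] (↥(bset D.toDomains) → ℝ) => T X) (QB_comp_hPrimeMLT hG)
  simpa only [LinearMap.comp_apply, LinearMap.id_apply] using h

/-- expansion of a coarse function in point masses under a linear map to fine-lattice functions:
`(ΦX)(x) = Σ_{y′}(Φδ_{y′})(x)·X(y′)`. [folklore] -/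
private theorem apply_eq_sum_single {ι Y : Type} [Fintype ι] [DecidableEq ι] (Φ : (ι → ℝ) →ₗ[ℝ] (Y → ℝ)) (X : ι → ℝ)
    (x : Y) : Φ X x = ∑ y' : ι, Φ (Pi.single y' 1) x * X y' := by
  have hdec : X = ∑ y' : ι, X y' • (Pi.single y' (1 : ℝ) : ι → ℝ) := by
    funext z
    rw [Finset.sum_apply]
    simp [Pi.single_apply]
  conv_lhs => rw [hdec, map_sum, Finset.sum_apply]
  refine Finset.sum_congr rfl fun y' _ => ?_
  rw [map_smul, Pi.smul_apply, smul_eq_mul, mul_comm]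

/-- **p. 92's display on the torus: `(H′X)(x) = Σ_{y′∈𝔅}(L^{j′}η)^{d+1}H′(x, y′)X(y′)`** (the (2.69) convention for kernels on `𝔅`).
[cite: Balaban1985RegularSpaces, p.92; Balaban1984PropagatorsII, (2.69) p.235] -/
theorem hPrimeMLT_eq_sum (G : Module.End ℝ (↥(bset D.toDomains) → ℝ)) (X : ↥(bset D.toDomains) → ℝ)
    (x : ↥(boxDom (N0 ℓ Mh k P))) :
    hPrimeMLT D a G X x = ∑ y' : ↥(bset D.toDomains), W D.toDomains y' * hKerT D a G x y' * X y' := by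
  rw [apply_eq_sum_single]
  refine Finset.sum_congr rfl fun y' _ => ?_
  unfold hKerT
  rw [mul_div_cancel₀ _ (W_pos D.toDomains y').ne']

/-- the same for a fine-lattice operator applied after `H′` (used for `∂_μH′`, `Δ_TH′`):
`(T·H′X)(x) = Σ_{y′}(T·H′δ_{y′})(x)·X(y′)`. [cite: Balaban1985RegularSpaces, p.92; Balaban1984PropagatorsII, (2.69) p.235] -/
theorem mulVec_hPrimeMLT_eq_sum (T : Matrix ↥(boxDom (N0 ℓ Mh k P)) ↥(boxDom (N0 ℓ Mh k P)) ℝ)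
    (G : Module.End ℝ (↥(bset D.toDomains) → ℝ)) (X : ↥(bset D.toDomains) → ℝ) (x : ↥(boxDom (N0 ℓ Mh k P))) :
    (T *ᵥ hPrimeMLT D a G X) x = ∑ y' : ↥(bset D.toDomains), (T *ᵥ hPrimeMLT D a G (Pi.single y' 1)) x * X y' := by
  have h := apply_eq_sum_single (Matrix.toLin' T ∘ₗ hPrimeMLT D a G) X x
  simpa only [LinearMap.comp_apply, Matrix.toLin'_apply] using h

/-- `Q′*(Gδ_{y′})` is the column `z ↦ G(y(z), y′)` of the matrix of `G` (block-constant extension, `QsB_apply`).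
[cite: Balaban1984PropagatorsII, (2.69) p.235, p.248 («Q*»)] -/
theorem QsB_single_applyT (G : Module.End ℝ (↥(bset D.toDomains) → ℝ)) (y' : ↥(bset D.toDomains))
    (z : ↥(boxDom (N0 ℓ Mh k P))) :
    QsB D.toDomains (G (Pi.single y' 1)) z = mat G (blkOf D.toDomains z) y' := by
  rw [QsB_apply]; rfl

end HPrime

/-! ## §2  On the torus: the scale absorption (2.60) for `geomTB`, the composite majorants with `G′` -/

section Torus

variable {ℓ Mh k R : ℕ} {P : Fin (d + 1) → ℕ} {D : TDomains d ℓ Mh k P R}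

/-- **THE SCALE ABSORPTION ON THE TORUS** for an inverse power: `(L^{j″})⁻ⁿ ≦ Lⁿe^{βd_T(y,y″)}(L^{j})⁻ⁿ` under (2.60)
(`levelSepTB`) and `Lⁿ ≦ e^{β(RM−1)}` — the abstract `pow_len_le_of_levelSep` of the box file on `geomTB D`.
[cite: Balaban1984PropagatorsII, (2.60) p.234, p.235] -/
theorem inv_pow_lenT_le (hMh : 1 ≤ Mh) (hP : ∀ μ, 1 ≤ P μ) (hRM : 1 ≤ R * ((ℓ + 1) * Mh)) (n : ℕ) {β : ℝ}
    (hβ : 0 ≤ β) (hthr : ((ℓ : ℝ) + 1) ^ n ≤ Real.exp (β * ((geomTB D).R * (geomTB D).M)))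
    (y y'' : ↥(bset D.toDomains)) :
    ((geomT D).len y'' ^ n)⁻¹ ≤ ((ℓ : ℝ) + 1) ^ n * Real.exp (β * (geomT D).dist y y'') * ((geomT D).len y ^ n)⁻¹ := by
  have hL1 : (1 : ℝ) ≤ (geomTB D).L := by rw [geomTB_L]; linarith [(Nat.cast_nonneg ℓ : (0 : ℝ) ≤ ℓ)]
  have hη : (0 : ℝ) ≤ (geomTB D).eta := by rw [geomTB_eta]; exact zero_le_one
  have h := pow_len_le_of_levelSep (g := geomTB D) (levelSepTB D hMh hP hRM) (geomTB_RM_nonneg D hMh hRM) hL1 hη n hβ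
    (by rw [geomTB_L]; exact hthr) y y''
  change (geomT D).len y ^ n ≤ ((ℓ : ℝ) + 1) ^ n * Real.exp (β * (geomT D).dist y y'') * (geomT D).len y'' ^ n at h
  have hy : 0 < (geomT D).len y ^ n := pow_pos (lenT_pos D y) n
  have hy'' : 0 < (geomT D).len y'' ^ n := pow_pos (lenT_pos D y'') n
  rw [← div_eq_mul_inv, le_div_iff₀ hy, inv_mul_eq_div, div_le_iff₀ hy'']
  exact h

/-- … and for a positive power, in the orientation of a 𝔅-convolution: `(L^{j″})ⁿ ≦ Lⁿe^{βd_T(y,y″)}(L^{j})ⁿ` (symmetry of `d_T`).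
[cite: Balaban1984PropagatorsII, (2.60) p.234, p.235, (2.46) p.231] -/
theorem pow_lenT_le (hMh : 1 ≤ Mh) (hP : ∀ μ, 1 ≤ P μ) (hRM : 1 ≤ R * ((ℓ + 1) * Mh)) (n : ℕ) {β : ℝ}
    (hβ : 0 ≤ β) (hthr : ((ℓ : ℝ) + 1) ^ n ≤ Real.exp (β * ((geomTB D).R * (geomTB D).M)))
    (y y'' : ↥(bset D.toDomains)) :
    (geomT D).len y'' ^ n ≤ ((ℓ : ℝ) + 1) ^ n * Real.exp (β * (geomT D).dist y y'') * (geomT D).len y ^ n := by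
  have hL1 : (1 : ℝ) ≤ (geomTB D).L := by rw [geomTB_L]; linarith [(Nat.cast_nonneg ℓ : (0 : ℝ) ≤ ℓ)]
  have hη : (0 : ℝ) ≤ (geomTB D).eta := by rw [geomTB_eta]; exact zero_le_one
  have h := pow_len_le_of_levelSep (g := geomTB D) (levelSepTB D hMh hP hRM) (geomTB_RM_nonneg D hMh hRM) hL1 hη n hβ
    (by rw [geomTB_L]; exact hthr) y'' y
  have hs : (geomT D).dist y y'' = (geomT D).dist y'' y := symmT D y y''
  change (geomT D).len y'' ^ n ≤ ((ℓ : ℝ) + 1) ^ n * Real.exp (β * (geomT D).dist y'' y) * (geomT D).len y ^ n at h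
  rw [hs]
  exact h

/-- **THE COMPOSITE MAJORANT WITH `G′` ON THE TORUS** (the scale sum of (2.68) for one pair of factors): if `T` has the Prop.-2.2
majorant `C·p(y)·e^{−½δ₀d_T(y,y′)}` (`p ≥ 0` a level prefactor) and `T_G` the first-entry majorant `C(Lʲ)²e^{−½δ₀d_T(y,y′)}`, the
row sums at the rate `⅛δ₀` are `≦ c` and `L² ≦ e^{⅛δ₀(RM−1)}`, then `T·T_G` has majorant `C²L²c·p(y)(Lʲ)²·e^{−¼δ₀d_T(y,y′)}` —
(2.52)–(2.55) for the pair, the weight `(L^{j″})²` moved to `y` by (2.60), the middle point summed by (2.61), the end-to-end rate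
by (2.54). [cite: Balaban1984PropagatorsII, (2.68) p.235, (2.52)–(2.55) p.232, Lemma 2.1 (2.60)–(2.61) p.234] -/
theorem hasMajorant_compT (hMh : 1 ≤ Mh) (hP : ∀ μ, 1 ≤ P μ) (hRM : 1 ≤ R * ((ℓ + 1) * Mh))
    {T TG : Module.End ℝ (↥(boxDom (N0 ℓ Mh k P)) → ℝ)} {C δ₀ c : ℝ} (hC : 0 ≤ C) (hδ₀ : 0 < δ₀)
    {p : ↥(bset D.toDomains) → ℝ} (hp : ∀ y, 0 ≤ p y)
    (hT : HasMajorant (g := geomT D) (blkOf D.toDomains) T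
      (fun y y' => C * p y * Real.exp (-(δ₀ / 2 * (geomT D).dist y y'))))
    (hTG : HasMajorant (g := geomT D) (blkOf D.toDomains) TG
      (fun y y' => C * (geomT D).len y ^ 2 * Real.exp (-(δ₀ / 2 * (geomT D).dist y y'))))
    (h261 : ∀ y : (geomT D).Site, ∑ y'' : (geomT D).Site, Real.exp (-(δ₀ / 8 * (geomT D).dist y y'')) ≤ c)
    (hthr : ((ℓ : ℝ) + 1) ^ 2 ≤ Real.exp (δ₀ / 8 * ((geomTB D).R * (geomTB D).M))) :
    HasMajorant (g := geomT D) (blkOf D.toDomains) (T * TG)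
      (fun y y' => C ^ 2 * (((ℓ : ℝ) + 1) ^ 2 * c) * (p y * (geomT D).len y ^ 2) *
        Real.exp (-(δ₀ / 4 * (geomT D).dist y y'))) := by
  have htri := (triangle_refl_nonneg_T D hMh hP).1
  have hdnn := (triangle_refl_nonneg_T D hMh hP).2.2
  have hlen0 : ∀ y : ↥(bset D.toDomains), 0 ≤ (geomT D).len y := fun y => (lenT_pos D y).le
  have hf : ∀ y y'' : (geomT D).Site, (geomT D).len y'' ^ 2 ≤
      ((ℓ : ℝ) + 1) ^ 2 * Real.exp (δ₀ / 8 * (geomT D).dist y y'') * (geomT D).len y ^ 2 :=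
    fun y y'' => pow_lenT_le hMh hP hRM 2 (by positivity) hthr y y''
  refine hasMajorant_mono (g := geomT D) (blkOf D.toDomains)
    (hasMajorant_mul (g := geomT D) (blkOf D.toDomains) hT hTG fun a b => ?_) fun a b => ?_
  · exact mul_nonneg (mul_nonneg hC (pow_nonneg (hlen0 a) 2)) (Real.exp_nonneg _)
  · have hconv := levelConv_le (g := geomT D) htri hdnn (σ₁ := δ₀ / 2) (σ₂ := δ₀ / 2) (β := δ₀ / 8) (ρ := δ₀ / 4)
      (τ := δ₀ / 8) (A := ((ℓ : ℝ) + 1) ^ 2) (c := c) (by positivity) (by linarith) (by linarith) (by positivity)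
      (f := fun y => (geomT D).len y ^ 2) (fun y => pow_nonneg (hlen0 y) 2) hf h261 a b
    have hpa : 0 ≤ C ^ 2 * p a := mul_nonneg (pow_nonneg hC 2) (hp a)
    calc ∑ y'' : (geomT D).Site, C * p a * Real.exp (-(δ₀ / 2 * (geomT D).dist a y'')) *
          (C * (geomT D).len y'' ^ 2 * Real.exp (-(δ₀ / 2 * (geomT D).dist y'' b)))
        = C ^ 2 * p a * ∑ y'' : (geomT D).Site, Real.exp (-(δ₀ / 2 * (geomT D).dist a y'')) *
            (geomT D).len y'' ^ 2 * Real.exp (-(δ₀ / 2 * (geomT D).dist y'' b)) := by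
          rw [Finset.mul_sum]
          exact Finset.sum_congr rfl fun y'' _ => by ring
      _ ≤ C ^ 2 * p a * (((ℓ : ℝ) + 1) ^ 2 * c * (geomT D).len a ^ 2 *
            Real.exp (-(δ₀ / 4 * (geomT D).dist a b))) := mul_le_mul_of_nonneg_left hconv hpa
      _ = C ^ 2 * (((ℓ : ℝ) + 1) ^ 2 * c) * (p a * (geomT D).len a ^ 2) *
            Real.exp (-(δ₀ / 4 * (geomT D).dist a b)) := by ring

end Torus

/-! ## §3  The decaying kernel of (1.91) at U₀ = 1 on the `k`-level torus family («H′ ≺ κ_He^{−ρd_T}» with the level prefactors) -/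

section Kernel

/-- a negative real power of a positive length is the inverse of the natural power. [folklore] -/
private theorem rpow_neg_natCast_eq {x : ℝ} (hx : 0 < x) (n : ℕ) : x ^ (-(n : ℝ)) = (x ^ n)⁻¹ := by
  rw [Real.rpow_neg hx.le, Real.rpow_natCast]

/-- the same for the printed exponent `−4`. [folklore] -/
private theorem rpow_neg_four_eq {x : ℝ} (hx : 0 < x) : x ^ (-(4 : ℝ)) = (x ^ 4)⁻¹ := by
  rw [show (-(4 : ℝ)) = -((4 : ℕ) : ℝ) by norm_num]
  exact rpow_neg_natCast_eq hx 4

/-- **THE KERNEL OF (1.91) AT U₀ = 1 ON THE `k`-LEVEL TORUS FAMILY DECAYS, WITH THE LEVEL PREFACTORS `[1, (Lʲ)⁻¹, (Lʲ)⁻²]`** (the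
operator form «H′ ≺ κ_He^{−ρd}, ∇H′ ≺ κ_H(Lʲη)⁻¹e^{−ρd}, ΔH′ ≺ κ_H(Lʲη)⁻²e^{−ρd}» of `B8Ineq192Op.ineq192_op`, now for the GENUINE
`G′ = gmlT`, `Q′*` of [B6] §2 ON THE TORUS, the three Prop.-2.2 majorants and the (2.87)-bound of `(Q′G′²Q′*)⁻¹` entering as
hypotheses): for all `C, δ₀, C₁, δ₁ > 0` there are `ρ, B > 0`, `N₁ ≥ 1` (functions of `d`, `ℓ`, `C`, `δ₀`, `C₁`, `δ₁`) such that
for every number of levels `k`, every `M_h ≥ 1`, every `R` with `R·L·M_h ≥ N₁ + 1` («RM sufficiently large»), every torus size `P`,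
every nested torus family `D` with (2.1)–(2.2), every weight sequence `a`, every family `Dd μ` of fine-lattice matrices (the
difference operators `∇`) and every fine-lattice matrix `Lap` (the Laplacian), IF `G′` has the first-entry majorant
`C·L^{2j}e^{−½δ₀d_T(y,y′)}`, each `Dd μ·G′` the second-entry majorant `C·Lʲe^{−½δ₀d_T}` and `Lap·G′` the sixth-entry majorant
`Ce^{−½δ₀d_T}` (the conclusions of [B6] Prop. 2.2 for this family, p21's `prop22_first/second/sixth_multiLevelTorus` with
`Dd μ = dT N₀ μ`, `Lap = perLapT N₀ = −Δ_T`), THEN for EVERY operator `G` on `𝔅` with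
`|G(y, y′)| ≦ C₁(Lʲ)⁻⁴(L^{j′})^{−(d+1)}e^{−½δ₁d_T(y,y′)}` (the printed bound (2.87) of [B6] Prop. 2.3 for `(Q′G′²Q′*)⁻¹`, in the (2.69)
convention `G(y, y′) = mat G y y′ / W(y′)`), every block `y′ ∈ 𝔅` and every point `x` of the torus at its level `j = D.lev x`
(`x ∈ B^j(Λ_j) ⊂ Ω_j`): `|(H′δ_{y′})(x)| ≦ Be^{−ρd_T(y(x),y′)}`, `|(Dd μ·H′δ_{y′})(x)| ≦ B(Lʲ)⁻¹e^{−ρd_T(y(x),y′)}` (every `μ`),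
`|(Lap·H′δ_{y′})(x)| ≦ B(Lʲ)⁻²e^{−ρd_T(y(x),y′)}` — for `H′ = G′²Q′*G` (`hPrimeMLT`).  Mechanism = the box file's:
the three majorants composed with `G′` once more (§2), applied to the (2.87)-column `z ↦ G(y(z), y′)` of `Q′*G`, the weight
`(L^{j(z)})⁻⁴` moved to `x` by (2.60), the middle point summed by (2.61) (`lemma21_torus`), the end-to-end rate by (2.54).
[cite: Balaban1985RegularSpaces, (1.91)–(1.92) pp.91–92, p.93 l.1–4; Balaban1984PropagatorsII, Prop. 2.2 (2.67) p.234, Prop. 2.3 (2.87) p.238, Lemma 2.1 (2.60)–(2.61) p.234, (2.52)–(2.55) p.232, (2.68) p.235, p.224 (Ω₁ = T_η admitted)] -/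
theorem hPrime_single_decay_T (d ℓ : ℕ) {C δ₀ C₁ δ₁ : ℝ} (hC : 0 < C) (hδ₀ : 0 < δ₀) (hC₁ : 0 < C₁) (hδ₁ : 0 < δ₁) :
    ∃ ρ B : ℝ, ∃ N₁ : ℕ, 0 < ρ ∧ 0 < B ∧ 0 < N₁ ∧
      ∀ (k Mh R : ℕ), 1 ≤ Mh → N₁ + 1 ≤ R * ((ℓ + 1) * Mh) →
      ∀ (P : Fin (d + 1) → ℕ) (_hP : ∀ μ, 1 ≤ P μ) (D : TDomains d ℓ Mh k P R) (a : ℕ → ℝ)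
        (Dd : Fin (d + 1) → Matrix ↥(boxDom (N0 ℓ Mh k P)) ↥(boxDom (N0 ℓ Mh k P)) ℝ)
        (Lap : Matrix ↥(boxDom (N0 ℓ Mh k P)) ↥(boxDom (N0 ℓ Mh k P)) ℝ),
        HasMajorant (g := geomT D) (blkOf D.toDomains) (Matrix.toLin' (gmlT (N0 ℓ Mh k P) ℓ k D.lev a))
          (fun y y' => C * ((ℓ : ℝ) + 1) ^ (2 * y.1.1) * Real.exp (-(δ₀ / 2 * (geomT D).dist y y'))) →
        (∀ μ : Fin (d + 1), HasMajorant (g := geomT D) (blkOf D.toDomains)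
          (Matrix.toLin' (Dd μ * gmlT (N0 ℓ Mh k P) ℓ k D.lev a))
          (fun y y' => C * ((ℓ : ℝ) + 1) ^ y.1.1 * Real.exp (-(δ₀ / 2 * (geomT D).dist y y')))) →
        HasMajorant (g := geomT D) (blkOf D.toDomains)
          (Matrix.toLin' (Lap * gmlT (N0 ℓ Mh k P) ℓ k D.lev a))
          (fun y y' => C * Real.exp (-(δ₀ / 2 * (geomT D).dist y y'))) →
        ∀ G : Module.End ℝ (↥(bset D.toDomains) → ℝ),
          (∀ y y' : ↥(bset D.toDomains), |mat G y y' / W D.toDomains y'| ≤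
            C₁ * (geomT D).len y ^ (-(4 : ℝ)) * (geomT D).len y' ^ (-((d + 1 : ℕ) : ℝ)) *
              Real.exp (-(δ₁ / 2 * (geomT D).dist y y'))) →
          ∀ (x : ↥(boxDom (N0 ℓ Mh k P))) (y' : ↥(bset D.toDomains)),
            |hPrimeMLT D a G (Pi.single y' 1) x| ≤ B * Real.exp (-(ρ * (geomT D).dist (blkOf D.toDomains x) y')) ∧
            (∀ μ : Fin (d + 1), |(Dd μ *ᵥ hPrimeMLT D a G (Pi.single y' 1)) x| ≤
              B * (((ℓ : ℝ) + 1) ^ D.lev x.1)⁻¹ * Real.exp (-(ρ * (geomT D).dist (blkOf D.toDomains x) y'))) ∧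
            |(Lap *ᵥ hPrimeMLT D a G (Pi.single y' 1)) x| ≤
              B * ((((ℓ : ℝ) + 1) ^ D.lev x.1) ^ 2)⁻¹ * Real.exp (-(ρ * (geomT D).dist (blkOf D.toDomains x) y')) := by
  have hL0 : (0 : ℝ) < (ℓ : ℝ) + 1 := by positivity
  have hL1 : (1 : ℝ) ≤ (ℓ : ℝ) + 1 := by linarith [(Nat.cast_nonneg ℓ : (0 : ℝ) ≤ ℓ)]
  have hlog : Real.log ((ℓ : ℝ) + 1) ≤ (ℓ : ℝ) + 1 := (Real.log_le_sub_one_of_pos hL0).trans (by linarith)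
  have hlog0 : 0 ≤ Real.log ((ℓ : ℝ) + 1) := Real.log_nonneg hL1
  -- the output rate `σ = min(δ₀/16, δ₁/2)` (also the smallest (2.61)-rate) and the (2.59)-type threshold `N₁`
  obtain ⟨σ, hσ⟩ : ∃ σ : ℝ, σ = min (δ₀ / 16) (δ₁ / 2) := ⟨_, rfl⟩
  have hσ0 : 0 < σ := by rw [hσ]; exact lt_min (by positivity) (by positivity)
  have hσδ₀ : σ ≤ δ₀ / 16 := by rw [hσ]; exact min_le_left _ _
  have hσδ₁ : σ ≤ δ₁ / 2 := by rw [hσ]; exact min_le_right _ _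
  obtain ⟨N₁, hN₁⟩ : ∃ N₁ : ℕ, N₁ = ⌈128 * ((d : ℝ) + 1) * ((ℓ : ℝ) + 1) / σ⌉₊ + 1 := ⟨_, rfl⟩
  have hN₁pos : 0 < N₁ := by rw [hN₁]; omega
  have hN₁gt : 128 * ((d : ℝ) + 1) * ((ℓ : ℝ) + 1) < σ * (N₁ : ℝ) := by
    have h : 128 * ((d : ℝ) + 1) * ((ℓ : ℝ) + 1) / σ < (N₁ : ℝ) := by
      rw [hN₁]; push_cast
      exact lt_of_le_of_lt (Nat.le_ceil _) (by linarith)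
    rw [div_lt_iff₀ hσ0] at h
    linarith
  -- the (2.61)-constant and the constant `B`
  obtain ⟨cK, hcK⟩ : ∃ cK : ℝ, cK = K261 N₁ (d + 1) ((ℓ : ℝ) + 1) 1 (1 * σ) := ⟨_, rfl⟩
  have hcK0 : 0 ≤ cK := by rw [hcK]; exact K261_nonneg hL0.le zero_le_one
  obtain ⟨B, hB⟩ : ∃ B : ℝ, B = C₁ * C ^ 2 * ((ℓ : ℝ) + 1) ^ 6 * cK ^ 2 := ⟨_, rfl⟩
  have hB0 : 0 ≤ B := by rw [hB]; positivity
  refine ⟨σ, B + 1, N₁, hσ0, by linarith, hN₁pos, ?_⟩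
  intro k Mh R hMh1 hRM1 P hP D a Dd Lap hTG hTD hTL G hG x y'
  have hRMone : 1 ≤ R * ((ℓ + 1) * Mh) := le_trans (by omega) hRM1
  have htri := (triangle_refl_nonneg_T D hMh1 hP).1
  have hdnn := (triangle_refl_nonneg_T D hMh1 hP).2.2
  have hlen0 : ∀ y : ↥(bset D.toDomains), 0 ≤ (geomT D).len y := fun y => (lenT_pos D y).le
  -- Lemma 2.1 on the torus at the rate `σ`, and every larger rate
  have hθ : Real.exp (-(1 * σ)) * ((ℓ : ℝ) + 1) ^ ((2 * (d + 1 : ℕ) : ℝ) / N₁) < 1 := by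
    refine theta_lt_one_of_log hL0 hN₁pos ?_
    push_cast
    nlinarith [mul_le_mul_of_nonneg_left hlog (by positivity : (0 : ℝ) ≤ 2 * ((d : ℝ) + 1))]
  obtain ⟨-, h261, -, -⟩ := lemma21_torus D hMh1 hP hN₁pos hRM1 hσ0.le (α := 1) zero_le_one le_rfl hθ
  rw [← hcK] at h261
  have hrow : ∀ τ : ℝ, σ ≤ τ → ∀ y : (geomT D).Site,
      ∑ y'' : (geomT D).Site, Real.exp (-(τ * (geomT D).dist y y'')) ≤ cK := by
    intro τ hτ y
    have h := ineq261With_of_le (g := geomT D) h261 (δ' := τ) (α' := 1) (by linarith) hdnn y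
    simpa only [one_mul] using h
  -- the thresholds `L⁴ ≤ e^{⅛δ₀(RM−1)}` and `L² ≤ e^{⅛δ₀(RM−1)}`
  have hthr4 : ((ℓ : ℝ) + 1) ^ 4 ≤ Real.exp (δ₀ / 8 * ((geomTB D).R * (geomTB D).M)) := by
    rw [geomTB_RM D hMh1]
    have hge : (N₁ : ℝ) ≤ (R : ℝ) * (((ℓ : ℝ) + 1) * Mh) - 1 := by
      have : ((N₁ + 1 : ℕ) : ℝ) ≤ ((R * ((ℓ + 1) * Mh) : ℕ) : ℝ) := by exact_mod_cast hRM1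
      push_cast at this; linarith
    have h4 : 4 * Real.log ((ℓ : ℝ) + 1) ≤ δ₀ / 8 * ((R : ℝ) * (((ℓ : ℝ) + 1) * Mh) - 1) := by
      have h1 : σ * (N₁ : ℝ) ≤ δ₀ / 8 * ((R : ℝ) * (((ℓ : ℝ) + 1) * Mh) - 1) :=
        calc σ * (N₁ : ℝ) ≤ δ₀ / 8 * (N₁ : ℝ) := mul_le_mul_of_nonneg_right (by linarith) (Nat.cast_nonneg _)
          _ ≤ δ₀ / 8 * ((R : ℝ) * (((ℓ : ℝ) + 1) * Mh) - 1) := mul_le_mul_of_nonneg_left hge (by positivity)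
      have hd0 : (0 : ℝ) ≤ (d : ℝ) := Nat.cast_nonneg d
      nlinarith
    calc ((ℓ : ℝ) + 1) ^ 4 = Real.exp (4 * Real.log ((ℓ : ℝ) + 1)) := by
          rw [← Real.exp_log (pow_pos hL0 4), Real.log_pow]; norm_num
      _ ≤ _ := Real.exp_le_exp.2 h4
  have hthr2 : ((ℓ : ℝ) + 1) ^ 2 ≤ Real.exp (δ₀ / 8 * ((geomTB D).R * (geomTB D).M)) :=
    (pow_le_pow_right₀ hL1 (by norm_num : 2 ≤ 4)).trans hthr4
  -- the Prop.-2.2 majorants with the lengths `(geomT D).len`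
  have hTG' : HasMajorant (g := geomT D) (blkOf D.toDomains) (Matrix.toLin' (gmlT (N0 ℓ Mh k P) ℓ k D.lev a))
      (fun y y' => C * (geomT D).len y ^ 2 * Real.exp (-(δ₀ / 2 * (geomT D).dist y y'))) := by
    refine hasMajorant_mono (g := geomT D) (blkOf D.toDomains) hTG fun y y' => le_of_eq ?_
    rw [lenT_eq, ← pow_mul, Nat.mul_comm]
  have hTD' : ∀ μ : Fin (d + 1), HasMajorant (g := geomT D) (blkOf D.toDomains)
      (Matrix.toLin' (Dd μ * gmlT (N0 ℓ Mh k P) ℓ k D.lev a))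
      (fun y y' => C * (geomT D).len y * Real.exp (-(δ₀ / 2 * (geomT D).dist y y'))) := by
    intro μ
    refine hasMajorant_mono (g := geomT D) (blkOf D.toDomains) (hTD μ) fun y y' => le_of_eq ?_
    rw [lenT_eq]
  have hTL' : HasMajorant (g := geomT D) (blkOf D.toDomains)
      (Matrix.toLin' (Lap * gmlT (N0 ℓ Mh k P) ℓ k D.lev a))
      (fun y y' => C * (1 : ℝ) * Real.exp (-(δ₀ / 2 * (geomT D).dist y y'))) := by
    refine hasMajorant_mono (g := geomT D) (blkOf D.toDomains) hTL fun y y' => le_of_eq ?_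
    rw [mul_one]
  -- the composite majorants of `G′G′`, `Dd μ G′·G′`, `(−Δ_T)G′·G′` (§2)
  have hσ8 : σ ≤ δ₀ / 8 := by linarith
  have hK0 := hasMajorant_compT (D := D) hMh1 hP hRMone hC.le hδ₀ (p := fun y => (geomT D).len y ^ 2)
    (fun y => pow_nonneg (hlen0 y) 2) hTG' hTG' (hrow (δ₀ / 8) hσ8) hthr2
  have hK1 : ∀ μ : Fin (d + 1), _ := fun μ => hasMajorant_compT (D := D) hMh1 hP hRMone hC.le hδ₀
    (p := fun y => (geomT D).len y) hlen0 (hTD' μ) hTG' (hrow (δ₀ / 8) hσ8) hthr2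
  have hp1 : ∀ _y : ↥(bset D.toDomains), (0 : ℝ) ≤ 1 := fun _ => zero_le_one
  have hK2 := hasMajorant_compT (D := D) hMh1 hP hRMone hC.le hδ₀ (p := fun _ => (1 : ℝ))
    hp1 hTL' hTG' (hrow (δ₀ / 8) hσ8) hthr2
  -- the `G`-step: `|G(y, y′)·W(y′)| ≤ C₁(Lʲ)⁻⁴e^{−½δ₁d_T}`; `u = Q′*(Gδ_{y′})` is the column `z ↦ mat G y(z) y′`
  have hmat : ∀ y : ↥(bset D.toDomains), |mat G y y'| ≤
      C₁ * (((geomT D).len y ^ 4)⁻¹ * Real.exp (-(δ₁ / 2 * (geomT D).dist y y'))) := by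
    intro y
    have h := hG y y'
    have hWpos := W_pos D.toDomains y'
    have hW : W D.toDomains y' = (geomT D).len y' ^ (d + 1) := W_eq_lenT_pow D y'
    rw [abs_div, abs_of_pos hWpos, div_le_iff₀ hWpos, rpow_neg_four_eq (lenT_pos D y),
      rpow_neg_natCast_eq (lenT_pos D y'), hW] at h
    calc |mat G y y'| ≤ _ := h
      _ = C₁ * ((geomT D).len y ^ 4)⁻¹ * Real.exp (-(δ₁ / 2 * (geomT D).dist y y')) *
            (((geomT D).len y' ^ (d + 1))⁻¹ * (geomT D).len y' ^ (d + 1)) := by ring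
      _ = C₁ * (((geomT D).len y ^ 4)⁻¹ * Real.exp (-(δ₁ / 2 * (geomT D).dist y y'))) := by
            rw [inv_mul_cancel₀ (pow_pos (lenT_pos D y') _).ne', mul_one, mul_assoc]
  have hu : ∀ z : ↥(boxDom (N0 ℓ Mh k P)), |QsB D.toDomains (G (Pi.single y' 1)) z| ≤
      C₁ * (((geomT D).len (blkOf D.toDomains z) ^ 4)⁻¹ *
        Real.exp (-(δ₁ / 2 * (geomT D).dist (blkOf D.toDomains z) y'))) :=
    fun z => by rw [QsB_single_applyT]; exact hmat _
  -- scale absorption for `(L^{j″})⁻⁴` and the 𝔅-convolution with the decaying column, for each left factor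
  have hf4 : ∀ y y'' : (geomT D).Site, ((geomT D).len y'' ^ 4)⁻¹ ≤
      ((ℓ : ℝ) + 1) ^ 4 * Real.exp (δ₀ / 8 * (geomT D).dist y y'') * ((geomT D).len y ^ 4)⁻¹ :=
    fun y y'' => inv_pow_lenT_le hMh1 hP hRMone 4 (by positivity) hthr4 y y''
  have key : ∀ {T : Module.End ℝ (↥(boxDom (N0 ℓ Mh k P)) → ℝ)} {p : ↥(bset D.toDomains) → ℝ}, (∀ y, 0 ≤ p y) →
      HasMajorant (g := geomT D) (blkOf D.toDomains) T
        (fun y y' => C ^ 2 * (((ℓ : ℝ) + 1) ^ 2 * cK) * (p y * (geomT D).len y ^ 2) *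
          Real.exp (-(δ₀ / 4 * (geomT D).dist y y'))) →
      |T (QsB D.toDomains (G (Pi.single y' 1))) x| ≤
        B * (p (blkOf D.toDomains x) * (geomT D).len (blkOf D.toDomains x) ^ 2 *
          ((geomT D).len (blkOf D.toDomains x) ^ 4)⁻¹) *
          Real.exp (-(σ * (geomT D).dist (blkOf D.toDomains x) y')) := by
    intro T p hp hT
    have h1 := abs_apply_le_of_levelBound (g := geomT D) (blkOf D.toDomains) hT
      (p := fun b => ((geomT D).len b ^ 4)⁻¹ * Real.exp (-(δ₁ / 2 * (geomT D).dist b y'))) hC₁.le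
      (fun b => mul_nonneg (inv_nonneg.2 (pow_nonneg (hlen0 b) 4)) (Real.exp_nonneg _)) hu x
    have h2 := levelConv_le (g := geomT D) htri hdnn (σ₁ := δ₀ / 4) (σ₂ := δ₁ / 2) (β := δ₀ / 8) (ρ := σ)
      (τ := δ₀ / 16) (A := ((ℓ : ℝ) + 1) ^ 4) (c := cK) hσ0.le hσδ₁ (by linarith) (by positivity)
      (f := fun b => ((geomT D).len b ^ 4)⁻¹) (fun b => inv_nonneg.2 (pow_nonneg (hlen0 b) 4)) hf4
      (hrow (δ₀ / 16) hσδ₀) (blkOf D.toDomains x) y'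
    refine h1.trans ?_
    have hq : 0 ≤ C ^ 2 * (((ℓ : ℝ) + 1) ^ 2 * cK) *
        (p (blkOf D.toDomains x) * (geomT D).len (blkOf D.toDomains x) ^ 2) :=
      mul_nonneg (by positivity) (mul_nonneg (hp _) (pow_nonneg (hlen0 _) 2))
    have hsum : ∑ b' : (geomT D).Site, C ^ 2 * (((ℓ : ℝ) + 1) ^ 2 * cK) *
          (p (blkOf D.toDomains x) * (geomT D).len (blkOf D.toDomains x) ^ 2) *
          Real.exp (-(δ₀ / 4 * (geomT D).dist (blkOf D.toDomains x) b')) *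
          (((geomT D).len b' ^ 4)⁻¹ * Real.exp (-(δ₁ / 2 * (geomT D).dist b' y')))
        = C ^ 2 * (((ℓ : ℝ) + 1) ^ 2 * cK) *
          (p (blkOf D.toDomains x) * (geomT D).len (blkOf D.toDomains x) ^ 2) *
          ∑ b' : (geomT D).Site, Real.exp (-(δ₀ / 4 * (geomT D).dist (blkOf D.toDomains x) b')) *
            ((geomT D).len b' ^ 4)⁻¹ * Real.exp (-(δ₁ / 2 * (geomT D).dist b' y')) := by
      rw [Finset.mul_sum]
      exact Finset.sum_congr rfl fun b' _ => by ring
    rw [hsum]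
    calc C₁ * (C ^ 2 * (((ℓ : ℝ) + 1) ^ 2 * cK) *
          (p (blkOf D.toDomains x) * (geomT D).len (blkOf D.toDomains x) ^ 2) *
          ∑ b' : (geomT D).Site, Real.exp (-(δ₀ / 4 * (geomT D).dist (blkOf D.toDomains x) b')) *
            ((geomT D).len b' ^ 4)⁻¹ * Real.exp (-(δ₁ / 2 * (geomT D).dist b' y')))
        ≤ C₁ * (C ^ 2 * (((ℓ : ℝ) + 1) ^ 2 * cK) *
          (p (blkOf D.toDomains x) * (geomT D).len (blkOf D.toDomains x) ^ 2) *
          (((ℓ : ℝ) + 1) ^ 4 * cK * ((geomT D).len (blkOf D.toDomains x) ^ 4)⁻¹ *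
            Real.exp (-(σ * (geomT D).dist (blkOf D.toDomains x) y')))) :=
          mul_le_mul_of_nonneg_left (mul_le_mul_of_nonneg_left h2 hq) hC₁.le
      _ = B * (p (blkOf D.toDomains x) * (geomT D).len (blkOf D.toDomains x) ^ 2 *
          ((geomT D).len (blkOf D.toDomains x) ^ 4)⁻¹) *
          Real.exp (-(σ * (geomT D).dist (blkOf D.toDomains x) y')) := by
          rw [hB]; ring
  -- the three bounds
  have hlx : (geomT D).len (blkOf D.toDomains x) = ((ℓ : ℝ) + 1) ^ D.lev x.1 := lenT_blkOf D x
  have hlam : 0 < ((ℓ : ℝ) + 1) ^ D.lev x.1 := pow_pos hL0 _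
  have hE : 0 ≤ Real.exp (-(σ * (geomT D).dist (blkOf D.toDomains x) y')) := Real.exp_nonneg _
  refine ⟨?_, fun μ => ?_, ?_⟩
  · have h := key (p := fun y => (geomT D).len y ^ 2) (fun y => pow_nonneg (hlen0 y) 2) hK0
    have e : hPrimeMLT D a G (Pi.single y' 1) x =
        (Matrix.toLin' (gmlT (N0 ℓ Mh k P) ℓ k D.lev a) * Matrix.toLin' (gmlT (N0 ℓ Mh k P) ℓ k D.lev a))
          (QsB D.toDomains (G (Pi.single y' 1))) x := rfl
    rw [e]
    refine h.trans ?_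
    rw [hlx]
    have e2 : (((ℓ : ℝ) + 1) ^ D.lev x.1) ^ 2 * (((ℓ : ℝ) + 1) ^ D.lev x.1) ^ 2 *
        ((((ℓ : ℝ) + 1) ^ D.lev x.1) ^ 4)⁻¹ = 1 := by
      field_simp
    rw [e2, mul_one]
    exact mul_le_mul_of_nonneg_right (by linarith) hE
  · have h := key (p := fun y => (geomT D).len y) hlen0 (hK1 μ)
    have e : (Dd μ *ᵥ hPrimeMLT D a G (Pi.single y' 1)) x =
        (Matrix.toLin' (Dd μ * gmlT (N0 ℓ Mh k P) ℓ k D.lev a) *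
          Matrix.toLin' (gmlT (N0 ℓ Mh k P) ℓ k D.lev a)) (QsB D.toDomains (G (Pi.single y' 1))) x := by
      simp only [hPrimeMLT, LinearMap.comp_apply, Module.End.mul_apply, Matrix.toLin'_apply, Matrix.mulVec_mulVec,
        Matrix.mul_assoc]
    rw [e]
    refine h.trans ?_
    rw [hlx]
    have e2 : ((ℓ : ℝ) + 1) ^ D.lev x.1 * (((ℓ : ℝ) + 1) ^ D.lev x.1) ^ 2 *
        ((((ℓ : ℝ) + 1) ^ D.lev x.1) ^ 4)⁻¹ = (((ℓ : ℝ) + 1) ^ D.lev x.1)⁻¹ := by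
      field_simp
    rw [e2]
    refine mul_le_mul_of_nonneg_right ?_ hE
    have h0 : 0 ≤ (((ℓ : ℝ) + 1) ^ D.lev x.1)⁻¹ := inv_nonneg.2 hlam.le
    exact mul_le_mul_of_nonneg_right (by linarith) h0
  · have h := key (p := fun _ => (1 : ℝ)) hp1 hK2
    have e : (Lap *ᵥ hPrimeMLT D a G (Pi.single y' 1)) x =
        (Matrix.toLin' (Lap * gmlT (N0 ℓ Mh k P) ℓ k D.lev a) *
          Matrix.toLin' (gmlT (N0 ℓ Mh k P) ℓ k D.lev a)) (QsB D.toDomains (G (Pi.single y' 1))) x := by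
      simp only [hPrimeMLT, LinearMap.comp_apply, Module.End.mul_apply, Matrix.toLin'_apply, Matrix.mulVec_mulVec,
        Matrix.mul_assoc]
    rw [e]
    refine h.trans ?_
    rw [hlx]
    have e2 : (1 : ℝ) * (((ℓ : ℝ) + 1) ^ D.lev x.1) ^ 2 * ((((ℓ : ℝ) + 1) ^ D.lev x.1) ^ 4)⁻¹ =
        ((((ℓ : ℝ) + 1) ^ D.lev x.1) ^ 2)⁻¹ := by
      field_simp
    rw [e2]
    refine mul_le_mul_of_nonneg_right ?_ hE
    have h0 : 0 ≤ ((((ℓ : ℝ) + 1) ^ D.lev x.1) ^ 2)⁻¹ := inv_nonneg.2 (pow_pos hlam 2).le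
    exact mul_le_mul_of_nonneg_right (by linarith) h0

/-- a left factor `0` has every nonnegative majorant (used to discard the `∇`/`Δ` members when only the first is wanted).
[cite: Balaban1984PropagatorsII, (2.51) p.232, dictionary] -/
theorem hasMajorant_zero_mul {ℓ Mh k R : ℕ} {P : Fin (d + 1) → ℕ} (D : TDomains d ℓ Mh k P R)
    (T : Matrix ↥(boxDom (N0 ℓ Mh k P)) ↥(boxDom (N0 ℓ Mh k P)) ℝ) {K : ↥(bset D.toDomains) → ↥(bset D.toDomains) → ℝ}
    (hK : ∀ y y', 0 ≤ K y y') :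
    HasMajorant (g := geomT D) (blkOf D.toDomains)
      (Matrix.toLin' ((0 : Matrix ↥(boxDom (N0 ℓ Mh k P)) ↥(boxDom (N0 ℓ Mh k P)) ℝ) * T)) K := by
  intro y'' μf Bf hμf z
  rw [Matrix.zero_mul, Matrix.toLin'_apply, Matrix.zero_mulVec, Pi.zero_apply, abs_zero]
  exact mul_nonneg (hK _ _) hμf.nonneg

/-- **the (2.69)-kernel `H′(x, y′)` itself on the torus**: `|H′(x, y′)| ≦ B(L^{j′})^{−(d+1)}e^{−ρd_T(y(x),y′)}` (divide by the weight
`W(y′) = (L^{j′})^{d+1}`), the shape in which [B6]/[4] print kernels on `𝔅` — under the FIRST-entry majorant of `G′` and the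
(2.87)-bound of `G` only (the `∇`/`Δ` hypotheses of `hPrime_single_decay_T` are fed the zero operators).
[cite: Balaban1985RegularSpaces, p.92; Balaban1984PropagatorsII, (2.69) p.235, Prop. 2.3 (2.87) p.238] -/
theorem hKer_decay_T (d ℓ : ℕ) {C δ₀ C₁ δ₁ : ℝ} (hC : 0 < C) (hδ₀ : 0 < δ₀) (hC₁ : 0 < C₁) (hδ₁ : 0 < δ₁) :
    ∃ ρ B : ℝ, ∃ N₁ : ℕ, 0 < ρ ∧ 0 < B ∧ 0 < N₁ ∧
      ∀ (k Mh R : ℕ), 1 ≤ Mh → N₁ + 1 ≤ R * ((ℓ + 1) * Mh) →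
      ∀ (P : Fin (d + 1) → ℕ) (_hP : ∀ μ, 1 ≤ P μ) (D : TDomains d ℓ Mh k P R) (a : ℕ → ℝ),
        HasMajorant (g := geomT D) (blkOf D.toDomains) (Matrix.toLin' (gmlT (N0 ℓ Mh k P) ℓ k D.lev a))
          (fun y y' => C * ((ℓ : ℝ) + 1) ^ (2 * y.1.1) * Real.exp (-(δ₀ / 2 * (geomT D).dist y y'))) →
        ∀ G : Module.End ℝ (↥(bset D.toDomains) → ℝ),
          (∀ y y' : ↥(bset D.toDomains), |mat G y y' / W D.toDomains y'| ≤
            C₁ * (geomT D).len y ^ (-(4 : ℝ)) * (geomT D).len y' ^ (-((d + 1 : ℕ) : ℝ)) *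
              Real.exp (-(δ₁ / 2 * (geomT D).dist y y'))) →
          ∀ (x : ↥(boxDom (N0 ℓ Mh k P))) (y' : ↥(bset D.toDomains)),
            |hPrimeMLT D a G (Pi.single y' 1) x| ≤ B * Real.exp (-(ρ * (geomT D).dist (blkOf D.toDomains x) y')) ∧
            |hKerT D a G x y'| ≤ B * (W D.toDomains y')⁻¹ * Real.exp (-(ρ * (geomT D).dist (blkOf D.toDomains x) y')) := by
  obtain ⟨ρ, B, N₁, hρ, hB, hN₁, h⟩ := hPrime_single_decay_T d ℓ hC hδ₀ hC₁ hδ₁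
  refine ⟨ρ, B, N₁, hρ, hB, hN₁, ?_⟩
  intro k Mh R hMh hRM P hP D a hTG G hG x y'
  have hL0 : (0 : ℝ) < (ℓ : ℝ) + 1 := by positivity
  have hKD : ∀ y y' : ↥(bset D.toDomains), 0 ≤ C * ((ℓ : ℝ) + 1) ^ y.1.1 * Real.exp (-(δ₀ / 2 * (geomT D).dist y y')) :=
    fun y y' => mul_nonneg (mul_nonneg hC.le (pow_nonneg hL0.le _)) (Real.exp_nonneg _)
  have hKL : ∀ y y' : ↥(bset D.toDomains), 0 ≤ C * Real.exp (-(δ₀ / 2 * (geomT D).dist y y')) :=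
    fun y y' => mul_nonneg hC.le (Real.exp_nonneg _)
  have h1 := (h k Mh R hMh hRM P hP D a (fun _ => 0) 0 hTG
    (fun _ => hasMajorant_zero_mul D _ hKD) (hasMajorant_zero_mul D _ hKL) G hG x y').1
  refine ⟨h1, ?_⟩
  have hW := W_pos D.toDomains y'
  unfold hKerT
  rw [abs_div, abs_of_pos hW, div_le_iff₀ hW, mul_assoc (B * (W D.toDomains y')⁻¹), mul_comm (B * (W D.toDomains y')⁻¹),
    ← mul_assoc, mul_assoc _ B, mul_comm _ (B * (W D.toDomains y')⁻¹)]
  calc |hPrimeMLT D a G (Pi.single y' 1) x| ≤ B * Real.exp (-(ρ * (geomT D).dist (blkOf D.toDomains x) y')) := h1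
    _ = B * (W D.toDomains y')⁻¹ * (Real.exp (-(ρ * (geomT D).dist (blkOf D.toDomains x) y')) * W D.toDomains y') := by
        field_simp

end Kernel

/-! ## §4  (1.92) and the Δ-entry at U₀ = 1 on the `k`-level torus family -/

section Main

/-- **(1.92) AND THE p. 93 Δ-ENTRY AT U₀ = 1 ON THE `k`-LEVEL TORUS FAMILY, THE PROP.-2.2 MAJORANTS AND THE INVERSE
`(Q′G′²Q′*)⁻¹` ENTERING AS ARGUMENTS** — «|(H′X)(x)|, |(∇H′X)(x)| ≦ B′₀[1, (Lʲη)⁻¹]|X| for x ∈ Ω_j»: for all `C, δ₀, C₁, δ₁ > 0`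
there are `B′₀ > 0` and `N₁ ≥ 1` (functions of `d`, `ℓ`, `C`, `δ₀`, `C₁`, `δ₁`) such that for every number of levels `k`, every
`M_h ≥ 1`, every `R` with `R·L·M_h ≥ N₁ + 1` («RM sufficiently large»), every torus size `P`, every nested torus family `D` of
block-union domains with (2.1)–(2.2) (`Ω₁ = T_η`), every weight sequence `a`, every family `Dd μ` of fine matrices and every fine
matrix `Lap`, IF `G′ = gmlT` has the first-entry majorant `C·L^{2j}e^{−½δ₀d_T}`, each `Dd μ·G′` the second-entry majorant
`C·Lʲe^{−½δ₀d_T}` and `Lap·G′` the sixth-entry majorant `Ce^{−½δ₀d_T}` ([B6] Prop. 2.2 for this family: p21's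
`prop22_first/second/sixth_multiLevelTorus` with `Dd μ = dT N₀ μ = ∇^η_μ`, `Lap = perLapT N₀ = −Δ_T`), THEN for EVERY operator `G`
on `𝔅` with `|G(y, y′)| ≦ C₁(Lʲ)⁻⁴(L^{j′})^{−(d+1)}e^{−½δ₁d_T(y,y′)}` (the printed bound (2.87) of [B6] Prop. 2.3 for
`(Q′G′²Q′*)⁻¹`), every `X : 𝔅 → ℝ` with `|X(y′)| ≦ S` and every point `x` of the torus, at its level `j = D.lev x`
(`x ∈ B^j(Λ_j) ⊂ Ω_j`): `|(H′X)(x)| ≦ B′₀S`, `|(Dd μ·H′X)(x)| ≦ B′₀(Lʲ)⁻¹S` for every `μ`, and `|(Lap·H′X)(x)| ≦ B′₀(Lʲ)⁻²S`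
— for `H′ = G′²Q′*G` (`hPrimeMLT`) with the GENUINE torus `G′ = Δ′_a⁻¹`, `Q′*`.  From the kernel decay `hPrime_single_decay_T`
through p. 92's display `(H′X)(x) = Σ_{y′}(L^{j′}η)^{d+1}H′(x, y′)X(y′)` and the row sum (2.61) (`lemma21_torus`); print's
«B′₀ … depending on d and L only». [cite: Balaban1985RegularSpaces, (1.91)–(1.92) pp.91–92, p.93 l.1–4; Balaban1984PropagatorsII, Prop. 2.2 (2.67) p.234, Prop. 2.3 (2.87) p.238, Lemma 2.1 (2.60)–(2.61) p.234, (2.68) p.235, p.224 (Ω₁ = T_η admitted)] -/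
theorem ineq192_multiLevelTorus (d ℓ : ℕ) {C δ₀ C₁ δ₁ : ℝ} (hC : 0 < C) (hδ₀ : 0 < δ₀) (hC₁ : 0 < C₁) (hδ₁ : 0 < δ₁) :
    ∃ B₀' : ℝ, ∃ N₁ : ℕ, 0 < B₀' ∧ 0 < N₁ ∧
      ∀ (k Mh R : ℕ), 1 ≤ Mh → N₁ + 1 ≤ R * ((ℓ + 1) * Mh) →
      ∀ (P : Fin (d + 1) → ℕ) (_hP : ∀ μ, 1 ≤ P μ) (D : TDomains d ℓ Mh k P R) (a : ℕ → ℝ)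
        (Dd : Fin (d + 1) → Matrix ↥(boxDom (N0 ℓ Mh k P)) ↥(boxDom (N0 ℓ Mh k P)) ℝ)
        (Lap : Matrix ↥(boxDom (N0 ℓ Mh k P)) ↥(boxDom (N0 ℓ Mh k P)) ℝ),
        HasMajorant (g := geomT D) (blkOf D.toDomains) (Matrix.toLin' (gmlT (N0 ℓ Mh k P) ℓ k D.lev a))
          (fun y y' => C * ((ℓ : ℝ) + 1) ^ (2 * y.1.1) * Real.exp (-(δ₀ / 2 * (geomT D).dist y y'))) →
        (∀ μ : Fin (d + 1), HasMajorant (g := geomT D) (blkOf D.toDomains)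
          (Matrix.toLin' (Dd μ * gmlT (N0 ℓ Mh k P) ℓ k D.lev a))
          (fun y y' => C * ((ℓ : ℝ) + 1) ^ y.1.1 * Real.exp (-(δ₀ / 2 * (geomT D).dist y y')))) →
        HasMajorant (g := geomT D) (blkOf D.toDomains)
          (Matrix.toLin' (Lap * gmlT (N0 ℓ Mh k P) ℓ k D.lev a))
          (fun y y' => C * Real.exp (-(δ₀ / 2 * (geomT D).dist y y'))) →
        ∀ G : Module.End ℝ (↥(bset D.toDomains) → ℝ),
          (∀ y y' : ↥(bset D.toDomains), |mat G y y' / W D.toDomains y'| ≤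
            C₁ * (geomT D).len y ^ (-(4 : ℝ)) * (geomT D).len y' ^ (-((d + 1 : ℕ) : ℝ)) *
              Real.exp (-(δ₁ / 2 * (geomT D).dist y y'))) →
          ∀ (X : ↥(bset D.toDomains) → ℝ) (S : ℝ), 0 ≤ S → (∀ y', |X y'| ≤ S) →
            ∀ x : ↥(boxDom (N0 ℓ Mh k P)),
              |hPrimeMLT D a G X x| ≤ B₀' * S ∧
              (∀ μ : Fin (d + 1), |(Dd μ *ᵥ hPrimeMLT D a G X) x| ≤
                B₀' * (((ℓ : ℝ) + 1) ^ D.lev x.1)⁻¹ * S) ∧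
              |(Lap *ᵥ hPrimeMLT D a G X) x| ≤
                B₀' * ((((ℓ : ℝ) + 1) ^ D.lev x.1) ^ 2)⁻¹ * S := by
  obtain ⟨ρ, B, N₁, hρ, hB, hN₁, hker⟩ := hPrime_single_decay_T d ℓ hC hδ₀ hC₁ hδ₁
  have hL0 : (0 : ℝ) < (ℓ : ℝ) + 1 := by positivity
  have hL1 : (1 : ℝ) ≤ (ℓ : ℝ) + 1 := by linarith [(Nat.cast_nonneg ℓ : (0 : ℝ) ≤ ℓ)]
  have hlog : Real.log ((ℓ : ℝ) + 1) ≤ (ℓ : ℝ) + 1 := (Real.log_le_sub_one_of_pos hL0).trans (by linarith)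
  -- the (2.59)-type threshold for Lemma 2.1 at the rate `ρ`, and its constant
  obtain ⟨N₂, hN₂⟩ : ∃ N₂ : ℕ, N₂ = ⌈4 * ((d : ℝ) + 1) * ((ℓ : ℝ) + 1) / ρ⌉₊ + 1 := ⟨_, rfl⟩
  have hN₂pos : 0 < N₂ := by rw [hN₂]; omega
  have hN₂gt : 4 * ((d : ℝ) + 1) * ((ℓ : ℝ) + 1) < ρ * (N₂ : ℝ) := by
    have h : 4 * ((d : ℝ) + 1) * ((ℓ : ℝ) + 1) / ρ < (N₂ : ℝ) := by
      rw [hN₂]; push_cast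
      exact lt_of_le_of_lt (Nat.le_ceil _) (by linarith)
    rw [div_lt_iff₀ hρ] at h
    linarith
  obtain ⟨cK, hcK⟩ : ∃ cK : ℝ, cK = K261 N₂ (d + 1) ((ℓ : ℝ) + 1) 1 (1 * ρ) := ⟨_, rfl⟩
  have hcK0 : 0 ≤ cK := by rw [hcK]; exact K261_nonneg hL0.le zero_le_one
  refine ⟨B * cK + 1, max N₁ N₂, by positivity, lt_of_lt_of_le hN₁ (le_max_left _ _), ?_⟩
  intro k Mh R hMh1 hRM P hP D a Dd Lap hTG hTD hTL G hG X S hS hX x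
  have hRM1 : N₁ + 1 ≤ R * ((ℓ + 1) * Mh) := le_trans (Nat.succ_le_succ (le_max_left _ _)) hRM
  have hRM2 : N₂ + 1 ≤ R * ((ℓ + 1) * Mh) := le_trans (Nat.succ_le_succ (le_max_right _ _)) hRM
  have hK := hker k Mh R hMh1 hRM1 P hP D a Dd Lap hTG hTD hTL G hG x
  -- Lemma 2.1 on the torus at the rate `ρ`
  have hθ : Real.exp (-(1 * ρ)) * ((ℓ : ℝ) + 1) ^ ((2 * (d + 1 : ℕ) : ℝ) / N₂) < 1 := by
    refine theta_lt_one_of_log hL0 hN₂pos ?_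
    push_cast
    nlinarith [mul_le_mul_of_nonneg_left hlog (by positivity : (0 : ℝ) ≤ 2 * ((d : ℝ) + 1))]
  obtain ⟨-, h261, -, -⟩ := lemma21_torus D hMh1 hP hN₂pos hRM2 hρ.le (α := 1) zero_le_one le_rfl hθ
  rw [← hcK] at h261
  have hrow' : ∑ y' : (geomT D).Site, Real.exp (-(ρ * (geomT D).dist (blkOf D.toDomains x) y')) ≤ cK := by
    have h := h261 (blkOf D.toDomains x)
    simpa only [one_mul] using h
  have hrow : ∑ y' : ↥(bset D.toDomains), Real.exp (-(ρ * (geomT D).dist (blkOf D.toDomains x) y')) ≤ cK := hrow'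
  have hlam0 : 0 < ((ℓ : ℝ) + 1) ^ D.lev x.1 := pow_pos hL0 _
  have hBS : ∀ {q : ℝ}, 0 ≤ q → B * cK * q * S ≤ (B * cK + 1) * q * S := by
    intro q hq
    have e3 : (B * cK + 1) * q * S = B * cK * q * S + q * S := by ring
    rw [e3]
    linarith [mul_nonneg hq hS]
  refine ⟨?_, fun μ => ?_, ?_⟩
  · rw [apply_eq_sum_single]
    have h := abs_sum_mul_le_of_decay (dist := fun y' => (geomT D).dist (blkOf D.toDomains x) y') hB.le hS
      (fun y' => (hK y').1) hX hrow
    refine h.trans ?_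
    have h1 := hBS zero_le_one
    simp only [mul_one] at h1
    exact h1
  · rw [mulVec_hPrimeMLT_eq_sum]
    have h := abs_sum_mul_le_of_decay (dist := fun y' => (geomT D).dist (blkOf D.toDomains x) y')
      (B := B * (((ℓ : ℝ) + 1) ^ D.lev x.1)⁻¹) (mul_nonneg hB.le (inv_nonneg.2 hlam0.le)) hS
      (fun y' => (hK y').2.1 μ) hX hrow
    refine h.trans ?_
    calc B * (((ℓ : ℝ) + 1) ^ D.lev x.1)⁻¹ * cK * S = B * cK * (((ℓ : ℝ) + 1) ^ D.lev x.1)⁻¹ * S := by ring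
      _ ≤ (B * cK + 1) * (((ℓ : ℝ) + 1) ^ D.lev x.1)⁻¹ * S := hBS (inv_nonneg.2 hlam0.le)
  · rw [mulVec_hPrimeMLT_eq_sum]
    have h := abs_sum_mul_le_of_decay (dist := fun y' => (geomT D).dist (blkOf D.toDomains x) y')
      (B := B * ((((ℓ : ℝ) + 1) ^ D.lev x.1) ^ 2)⁻¹) (mul_nonneg hB.le (inv_nonneg.2 (pow_pos hlam0 2).le)) hS
      (fun y' => (hK y').2.2) hX hrow
    refine h.trans ?_
    calc B * ((((ℓ : ℝ) + 1) ^ D.lev x.1) ^ 2)⁻¹ * cK * S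
        = B * cK * ((((ℓ : ℝ) + 1) ^ D.lev x.1) ^ 2)⁻¹ * S := by ring
      _ ≤ (B * cK + 1) * ((((ℓ : ℝ) + 1) ^ D.lev x.1) ^ 2)⁻¹ * S := hBS (inv_nonneg.2 (pow_pos hlam0 2).le)

/-- **(1.92) at U₀ = 1 on the `k`-level torus family, in the sup norm** `|X| := max_{y′∈𝔅}|X(y′)|` («≦ B′₀[1, (Lʲη)⁻¹]|X|»),
under the hypotheses of `ineq192_multiLevelTorus`. [cite: Balaban1985RegularSpaces, (1.92) pp.91–92, p.93 l.1–4] -/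
theorem ineq192_multiLevelTorus_supNorm (d ℓ : ℕ) {C δ₀ C₁ δ₁ : ℝ} (hC : 0 < C) (hδ₀ : 0 < δ₀) (hC₁ : 0 < C₁)
    (hδ₁ : 0 < δ₁) :
    ∃ B₀' : ℝ, ∃ N₁ : ℕ, 0 < B₀' ∧ 0 < N₁ ∧
      ∀ (k Mh R : ℕ), 1 ≤ Mh → N₁ + 1 ≤ R * ((ℓ + 1) * Mh) →
      ∀ (P : Fin (d + 1) → ℕ) (_hP : ∀ μ, 1 ≤ P μ) (D : TDomains d ℓ Mh k P R) (a : ℕ → ℝ)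
        (Dd : Fin (d + 1) → Matrix ↥(boxDom (N0 ℓ Mh k P)) ↥(boxDom (N0 ℓ Mh k P)) ℝ)
        (Lap : Matrix ↥(boxDom (N0 ℓ Mh k P)) ↥(boxDom (N0 ℓ Mh k P)) ℝ),
        HasMajorant (g := geomT D) (blkOf D.toDomains) (Matrix.toLin' (gmlT (N0 ℓ Mh k P) ℓ k D.lev a))
          (fun y y' => C * ((ℓ : ℝ) + 1) ^ (2 * y.1.1) * Real.exp (-(δ₀ / 2 * (geomT D).dist y y'))) →
        (∀ μ : Fin (d + 1), HasMajorant (g := geomT D) (blkOf D.toDomains)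
          (Matrix.toLin' (Dd μ * gmlT (N0 ℓ Mh k P) ℓ k D.lev a))
          (fun y y' => C * ((ℓ : ℝ) + 1) ^ y.1.1 * Real.exp (-(δ₀ / 2 * (geomT D).dist y y')))) →
        HasMajorant (g := geomT D) (blkOf D.toDomains)
          (Matrix.toLin' (Lap * gmlT (N0 ℓ Mh k P) ℓ k D.lev a))
          (fun y y' => C * Real.exp (-(δ₀ / 2 * (geomT D).dist y y'))) →
        ∀ G : Module.End ℝ (↥(bset D.toDomains) → ℝ),
          (∀ y y' : ↥(bset D.toDomains), |mat G y y' / W D.toDomains y'| ≤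
            C₁ * (geomT D).len y ^ (-(4 : ℝ)) * (geomT D).len y' ^ (-((d + 1 : ℕ) : ℝ)) *
              Real.exp (-(δ₁ / 2 * (geomT D).dist y y'))) →
          ∀ (X : ↥(bset D.toDomains) → ℝ) (hne : (Finset.univ : Finset ↥(bset D.toDomains)).Nonempty)
            (x : ↥(boxDom (N0 ℓ Mh k P))),
              |hPrimeMLT D a G X x| ≤ B₀' * Finset.univ.sup' hne (fun y' => |X y'|) ∧
              (∀ μ : Fin (d + 1), |(Dd μ *ᵥ hPrimeMLT D a G X) x| ≤
                B₀' * (((ℓ : ℝ) + 1) ^ D.lev x.1)⁻¹ * Finset.univ.sup' hne (fun y' => |X y'|)) ∧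
              |(Lap *ᵥ hPrimeMLT D a G X) x| ≤
                B₀' * ((((ℓ : ℝ) + 1) ^ D.lev x.1) ^ 2)⁻¹ * Finset.univ.sup' hne (fun y' => |X y'|) := by
  obtain ⟨B₀', N₁, hB, hN₁, h⟩ := ineq192_multiLevelTorus d ℓ hC hδ₀ hC₁ hδ₁
  refine ⟨B₀', N₁, hB, hN₁, ?_⟩
  intro k Mh R hMh hRM P hP D a Dd Lap hTG hTD hTL G hG X hne x
  obtain ⟨y₀, hy₀⟩ := hne
  refine h k Mh R hMh hRM P hP D a Dd Lap hTG hTD hTL G hG X _ ?_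
    (fun y' => Finset.le_sup' (fun y' => |X y'|) (Finset.mem_univ y')) x
  exact le_trans (abs_nonneg _) (Finset.le_sup' (fun y' => |X y'|) (Finset.mem_univ y₀))

end Main

/-! ## §5  The projection `R = 1 − G′Q′*(Q′G′²Q′*)⁻¹Q′G′` of [4] (3.25) at U₀ = 1 on the `k`-level torus family: «|Rf| ≦ B′₀|f|» -/

section RProj

variable {ℓ Mh k R : ℕ} {P : Fin (d + 1) → ℕ} (D : TDomains d ℓ Mh k P R) (a : ℕ → ℝ)

/-- **The gauge-fixing projection at U₀ = 1 on the `k`-level TORUS family**: `R = 1 − G′·Q′*·G·Q′·G′` — the formula (3.25) of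
[4] «Rf = (I − G′Q′\*(Q′G′²Q′\*)⁻¹Q′G′)f» (= [B5] (1.44), the flat predecessor) for the GENUINE multi-level torus `G′ = Δ′_a⁻¹ = gmlT`,
`Q′`, `Q′*`, with `G` standing for `(Q′G′²Q′*)⁻¹`; B8's `R(U₀)` of (1.27) at the flat background on `T_η`. [cite: Balaban1985RegularSpaces, (1.27) p.80, p.92; Balaban1985BackgroundPropagators, (3.25) p.394; Balaban1984PropagatorsI, (1.44) p.25] -/
def rProjMLT (G : Module.End ℝ (↥(bset D.toDomains) → ℝ)) : Module.End ℝ (↥(boxDom (N0 ℓ Mh k P)) → ℝ) :=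
  1 - Matrix.toLin' (gmlT (N0 ℓ Mh k P) ℓ k D.lev a) * (QsB D.toDomains ∘ₗ G ∘ₗ QB D.toDomains) *
    Matrix.toLin' (gmlT (N0 ℓ Mh k P) ℓ k D.lev a)

variable {D a}

/-- `Rf = f − G′(Q′*(G(Q′(G′f))))`. [cite: Balaban1985BackgroundPropagators, (3.25) p.394] -/
theorem rProjMLT_apply (G : Module.End ℝ (↥(bset D.toDomains) → ℝ)) (f : ↥(boxDom (N0 ℓ Mh k P)) → ℝ) :
    rProjMLT D a G f = f - gmlT (N0 ℓ Mh k P) ℓ k D.lev a *ᵥ QsB D.toDomains (G (QB D.toDomains (gmlT (N0 ℓ Mh k P) ℓ k D.lev a *ᵥ f))) := by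
  simp only [rProjMLT, LinearMap.sub_apply, Module.End.one_apply, Module.End.mul_apply, LinearMap.comp_apply,
    Matrix.toLin'_apply]

/-- the letters `Q′·G′·G′·Q′*` ARE the operator `Q′G′²Q′*` with (2.69)-kernel `XkT` (`kerOp_XkT`).
[cite: Balaban1984PropagatorsII, (2.68)–(2.69) p.235] -/
theorem QB_gmlT_gmlT_QsB (w : ↥(bset D.toDomains) → ℝ) :
    QB D.toDomains (gmlT (N0 ℓ Mh k P) ℓ k D.lev a *ᵥ (gmlT (N0 ℓ Mh k P) ℓ k D.lev a *ᵥ QsB D.toDomains w)) = kerOp (W D.toDomains) (XkT D a) w := by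
  rw [kerOp_XkT]
  simp only [LinearMap.comp_apply, Matrix.toLin'_apply]

/-- **`Q′G′·R = 0`** (`Ran R ⊂ Δ′_aN(Q′)`, the subspace onto which [4] (3.21)–(3.25) / [B5] p. 25 project: «It is an orthogonal
projection on the linear subspace ΔN(Q′_k)»), from the inverse identity `(Q′G′²Q′*)·G = 1`. [cite: Balaban1984PropagatorsI, p.25; Balaban1985BackgroundPropagators, (3.21)–(3.25) p.394; Balaban1985RegularSpaces, (1.27) p.80] -/
theorem QB_gmlT_rProjMLT {G : Module.End ℝ (↥(bset D.toDomains) → ℝ)} (hG : kerOp (W D.toDomains) (XkT D a) * G = 1)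
    (f : ↥(boxDom (N0 ℓ Mh k P)) → ℝ) :
    QB D.toDomains (gmlT (N0 ℓ Mh k P) ℓ k D.lev a *ᵥ rProjMLT D a G f) = 0 := by
  have h2 : ∀ v, kerOp (W D.toDomains) (XkT D a) (G v) = v := fun v => by
    have h := congrArg (fun T : Module.End ℝ (↥(bset D.toDomains) → ℝ) => T v) hG
    simpa only [Module.End.mul_apply, Module.End.one_apply] using h
  rw [rProjMLT_apply, Matrix.mulVec_sub, map_sub, QB_gmlT_gmlT_QsB, h2, sub_self]

/-- **`R(G′Q′*X) = 0`**: `R` annihilates `Ran(G′Q′*)`, from the inverse identity `G·(Q′G′²Q′*) = 1` (the complement along which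
(3.22)'s minimiser is corrected). [cite: Balaban1985BackgroundPropagators, (3.22)–(3.25) p.394] -/
theorem rProjMLT_gmlT_QsB {G : Module.End ℝ (↥(bset D.toDomains) → ℝ)} (hG : G * kerOp (W D.toDomains) (XkT D a) = 1)
    (Xc : ↥(bset D.toDomains) → ℝ) :
    rProjMLT D a G (gmlT (N0 ℓ Mh k P) ℓ k D.lev a *ᵥ QsB D.toDomains Xc) = 0 := by
  have h1 : ∀ v, G (kerOp (W D.toDomains) (XkT D a) v) = v := fun v => by
    have h := congrArg (fun T : Module.End ℝ (↥(bset D.toDomains) → ℝ) => T v) hG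
    simpa only [Module.End.mul_apply, Module.End.one_apply] using h
  rw [rProjMLT_apply, QB_gmlT_gmlT_QsB, h1, sub_self]

/-- **`R² = R`** (R is a projection; [4] p. 394 / [B5] p. 25 «The projection operator R»), from `Q′G′·R = 0`.
[cite: Balaban1985BackgroundPropagators, (3.25) p.394; Balaban1984PropagatorsI, p.25] -/
theorem rProjMLT_idem {G : Module.End ℝ (↥(bset D.toDomains) → ℝ)} (hG : kerOp (W D.toDomains) (XkT D a) * G = 1)
    (f : ↥(boxDom (N0 ℓ Mh k P)) → ℝ) :
    rProjMLT D a G (rProjMLT D a G f) = rProjMLT D a G f := by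
  conv_lhs => rw [rProjMLT_apply]
  rw [QB_gmlT_rProjMLT hG, map_zero, map_zero, Matrix.mulVec_zero, sub_zero]

/-- **«|Rf| ≦ B′₀|f|» (p. 92) AT U₀ = 1 ON THE `k`-LEVEL TORUS FAMILY, THE FIRST-ENTRY MAJORANT AND THE INVERSE ENTERING AS
ARGUMENTS** — B8 p. 92: «from Theorems 3.1, 3.2 of [4] it follows that |Rf| ≦ B′₀|f|» (row B8.Claim@92): for all `C, δ₀, C₁, δ₁ > 0`
there are `B′₀ > 0`, `N₁ ≥ 1` such that for every `k`, `M_h ≥ 1`, `R` with `R·L·M_h ≥ N₁ + 1`, every torus size `P`, every nested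
torus family `D`, every weight sequence `a`, IF `G′ = gmlT` has the first-entry majorant `C·L^{2j}e^{−½δ₀d_T}` ([B6] Prop. 2.2,
p21's `prop22_first_multiLevelTorus`), THEN for every `G` with the (2.87)-bound, every fine function `f` with `|f(z)| ≦ S` and every
point `x`: `|(Rf)(x)| ≦ B′₀S` for `R = 1 − G′Q′*GQ′G′` (`rProjMLT`).  Chain (every level weight genuine): `|G′f| ≦ Cc(Lʲ)²S`
(first entry + (2.61)), `|Q′G′f(y)| ≦ Cc(Lʲ)²S` (`abs_QB_le`), `|G(Q′G′f)(y)| ≦ C₁CL²c²(Lʲ)⁻²S` ((2.87), the weight `(L^{j′})²`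
moved by (2.60), summed by (2.61)), `|G′Q′*(…)(x)| ≦ C₁C²L⁴c³S` (first entry, the weight `(L^{j′})⁻²` moved by (2.60), summed by
(2.61) = `lemma21_torus`). [cite: Balaban1985RegularSpaces, p.92; Balaban1985BackgroundPropagators, Thm 3.1 (3.42) p.397, Thm 3.2 (3.48) p.398, (3.25) p.394; Balaban1984PropagatorsII, Prop. 2.2 p.234, Prop. 2.3 (2.87) p.238, Lemma 2.1 (2.60)–(2.61) p.234, p.224 (Ω₁ = T_η admitted)] -/
theorem rProjMLT_sup_bound (d ℓ : ℕ) {C δ₀ C₁ δ₁ : ℝ} (hC : 0 < C) (hδ₀ : 0 < δ₀) (hC₁ : 0 < C₁) (hδ₁ : 0 < δ₁) :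
    ∃ B₀' : ℝ, ∃ N₁ : ℕ, 0 < B₀' ∧ 0 < N₁ ∧
      ∀ (k Mh R : ℕ), 1 ≤ Mh → N₁ + 1 ≤ R * ((ℓ + 1) * Mh) →
      ∀ (P : Fin (d + 1) → ℕ) (_hP : ∀ μ, 1 ≤ P μ) (D : TDomains d ℓ Mh k P R) (a : ℕ → ℝ),
        HasMajorant (g := geomT D) (blkOf D.toDomains) (Matrix.toLin' (gmlT (N0 ℓ Mh k P) ℓ k D.lev a))
          (fun y y' => C * ((ℓ : ℝ) + 1) ^ (2 * y.1.1) * Real.exp (-(δ₀ / 2 * (geomT D).dist y y'))) →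
        ∀ G : Module.End ℝ (↥(bset D.toDomains) → ℝ),
          (∀ y y' : ↥(bset D.toDomains), |mat G y y' / W D.toDomains y'| ≤
            C₁ * (geomT D).len y ^ (-(4 : ℝ)) * (geomT D).len y' ^ (-((d + 1 : ℕ) : ℝ)) *
              Real.exp (-(δ₁ / 2 * (geomT D).dist y y'))) →
          ∀ (f : ↥(boxDom (N0 ℓ Mh k P)) → ℝ) (S : ℝ), 0 ≤ S → (∀ z, |f z| ≤ S) →
            ∀ x : ↥(boxDom (N0 ℓ Mh k P)), |rProjMLT D a G f x| ≤ B₀' * S := by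
  have hL0 : (0 : ℝ) < (ℓ : ℝ) + 1 := by positivity
  have hL1 : (1 : ℝ) ≤ (ℓ : ℝ) + 1 := by linarith [(Nat.cast_nonneg ℓ : (0 : ℝ) ≤ ℓ)]
  have hlog : Real.log ((ℓ : ℝ) + 1) ≤ (ℓ : ℝ) + 1 := (Real.log_le_sub_one_of_pos hL0).trans (by linarith)
  have hlog0 : 0 ≤ Real.log ((ℓ : ℝ) + 1) := Real.log_nonneg hL1
  -- the smallest rate `σ = min(δ₀/4, δ₁/4)` and the threshold `N₁`
  obtain ⟨σ, hσ⟩ : ∃ σ : ℝ, σ = min (δ₀ / 4) (δ₁ / 4) := ⟨_, rfl⟩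
  have hσ0 : 0 < σ := by rw [hσ]; exact lt_min (by positivity) (by positivity)
  have hσδ₀ : σ ≤ δ₀ / 4 := by rw [hσ]; exact min_le_left _ _
  have hσδ₁ : σ ≤ δ₁ / 4 := by rw [hσ]; exact min_le_right _ _
  obtain ⟨N₁, hN₁⟩ : ∃ N₁ : ℕ, N₁ = ⌈128 * ((d : ℝ) + 1) * ((ℓ : ℝ) + 1) / σ⌉₊ + 1 := ⟨_, rfl⟩
  have hN₁pos : 0 < N₁ := by rw [hN₁]; omega
  have hN₁gt : 128 * ((d : ℝ) + 1) * ((ℓ : ℝ) + 1) < σ * (N₁ : ℝ) := by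
    have h : 128 * ((d : ℝ) + 1) * ((ℓ : ℝ) + 1) / σ < (N₁ : ℝ) := by
      rw [hN₁]; push_cast
      exact lt_of_le_of_lt (Nat.le_ceil _) (by linarith)
    rw [div_lt_iff₀ hσ0] at h
    linarith
  obtain ⟨cK, hcK⟩ : ∃ cK : ℝ, cK = K261 N₁ (d + 1) ((ℓ : ℝ) + 1) 1 (1 * σ) := ⟨_, rfl⟩
  have hcK0 : 0 ≤ cK := by rw [hcK]; exact K261_nonneg hL0.le zero_le_one
  obtain ⟨B, hB⟩ : ∃ B : ℝ, B = C₁ * C ^ 2 * ((ℓ : ℝ) + 1) ^ 4 * cK ^ 3 := ⟨_, rfl⟩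
  have hB0 : 0 ≤ B := by rw [hB]; positivity
  refine ⟨B + 1, N₁, by linarith, hN₁pos, ?_⟩
  intro k Mh R hMh1 hRM1 P hP D a hTG G hG f S hS hf x
  have hRMone : 1 ≤ R * ((ℓ + 1) * Mh) := le_trans (by omega) hRM1
  have hdnn := (triangle_refl_nonneg_T D hMh1 hP).2.2
  have hlen0 : ∀ y : ↥(bset D.toDomains), 0 ≤ (geomT D).len y := fun y => (lenT_pos D y).le
  -- Lemma 2.1 on the torus at the rate `σ`, and every larger rate
  have hθ : Real.exp (-(1 * σ)) * ((ℓ : ℝ) + 1) ^ ((2 * (d + 1 : ℕ) : ℝ) / N₁) < 1 := by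
    refine theta_lt_one_of_log hL0 hN₁pos ?_
    push_cast
    nlinarith [mul_le_mul_of_nonneg_left hlog (by positivity : (0 : ℝ) ≤ 2 * ((d : ℝ) + 1))]
  obtain ⟨-, h261, -, -⟩ := lemma21_torus D hMh1 hP hN₁pos hRM1 hσ0.le (α := 1) zero_le_one le_rfl hθ
  rw [← hcK] at h261
  have hrow : ∀ τ : ℝ, σ ≤ τ → ∀ y : (geomT D).Site,
      ∑ y'' : (geomT D).Site, Real.exp (-(τ * (geomT D).dist y y'')) ≤ cK := by
    intro τ hτ y
    have h := ineq261With_of_le (g := geomT D) h261 (δ' := τ) (α' := 1) (by linarith) hdnn y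
    simpa only [one_mul] using h
  -- the threshold `L² ≤ e^{σ(RM−1)}`, hence at the absorption rates `δ₀/4`, `δ₁/4`
  have hthr : ∀ β : ℝ, σ ≤ β → ((ℓ : ℝ) + 1) ^ 2 ≤ Real.exp (β * ((geomTB D).R * (geomTB D).M)) := by
    intro β hβ
    rw [geomTB_RM D hMh1]
    have hge : (N₁ : ℝ) ≤ (R : ℝ) * (((ℓ : ℝ) + 1) * Mh) - 1 := by
      have : ((N₁ + 1 : ℕ) : ℝ) ≤ ((R * ((ℓ + 1) * Mh) : ℕ) : ℝ) := by exact_mod_cast hRM1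
      push_cast at this; linarith
    have h2 : 2 * Real.log ((ℓ : ℝ) + 1) ≤ β * ((R : ℝ) * (((ℓ : ℝ) + 1) * Mh) - 1) := by
      have h1 : σ * (N₁ : ℝ) ≤ β * ((R : ℝ) * (((ℓ : ℝ) + 1) * Mh) - 1) :=
        calc σ * (N₁ : ℝ) ≤ β * (N₁ : ℝ) := mul_le_mul_of_nonneg_right hβ (Nat.cast_nonneg _)
          _ ≤ β * ((R : ℝ) * (((ℓ : ℝ) + 1) * Mh) - 1) := mul_le_mul_of_nonneg_left hge (by linarith)
      have hd0 : (0 : ℝ) ≤ (d : ℝ) := Nat.cast_nonneg d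
      nlinarith
    calc ((ℓ : ℝ) + 1) ^ 2 = Real.exp (2 * Real.log ((ℓ : ℝ) + 1)) := by
          rw [← Real.exp_log (pow_pos hL0 2), Real.log_pow]; norm_num
      _ ≤ _ := Real.exp_le_exp.2 h2
  -- the first-entry majorant with the lengths `(geomT D).len`
  have hTG' : HasMajorant (g := geomT D) (blkOf D.toDomains) (Matrix.toLin' (gmlT (N0 ℓ Mh k P) ℓ k D.lev a))
      (fun y y' => C * (geomT D).len y ^ 2 * Real.exp (-(δ₀ / 2 * (geomT D).dist y y'))) := by
    refine hasMajorant_mono (g := geomT D) (blkOf D.toDomains) hTG fun y y' => le_of_eq ?_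
    rw [lenT_eq, ← pow_mul, Nat.mul_comm]
  -- step 1: `|G′f(z)| ≤ C·c·S·(L^{j(z)})²`
  have hp1 : ∀ _y : ↥(bset D.toDomains), (0 : ℝ) ≤ 1 := fun _ => zero_le_one
  have hGf : ∀ z : ↥(boxDom (N0 ℓ Mh k P)), |(gmlT (N0 ℓ Mh k P) ℓ k D.lev a *ᵥ f) z| ≤
      C * cK * S * (geomT D).len (blkOf D.toDomains z) ^ 2 := by
    intro z
    have h1 := abs_apply_le_of_levelBound (g := geomT D) (blkOf D.toDomains) hTG' (p := fun _ => (1 : ℝ)) hS hp1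
      (fun z => by rw [mul_one]; exact hf z) z
    rw [Matrix.toLin'_apply] at h1
    refine h1.trans ?_
    have hr := hrow (δ₀ / 2) (by linarith) (blkOf D.toDomains z)
    have hsum : ∑ b' : (geomT D).Site, C * (geomT D).len (blkOf D.toDomains z) ^ 2 *
          Real.exp (-(δ₀ / 2 * (geomT D).dist (blkOf D.toDomains z) b')) * 1
        = C * (geomT D).len (blkOf D.toDomains z) ^ 2 * ∑ b' : (geomT D).Site,
            Real.exp (-(δ₀ / 2 * (geomT D).dist (blkOf D.toDomains z) b')) := by
      rw [Finset.mul_sum]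
      exact Finset.sum_congr rfl fun b' _ => by ring
    rw [hsum]
    have hq : 0 ≤ C * (geomT D).len (blkOf D.toDomains z) ^ 2 := mul_nonneg hC.le (pow_nonneg (hlen0 _) 2)
    calc S * (C * (geomT D).len (blkOf D.toDomains z) ^ 2 * ∑ b' : (geomT D).Site,
          Real.exp (-(δ₀ / 2 * (geomT D).dist (blkOf D.toDomains z) b')))
        ≤ S * (C * (geomT D).len (blkOf D.toDomains z) ^ 2 * cK) := mul_le_mul_of_nonneg_left (mul_le_mul_of_nonneg_left hr hq) hS
      _ = C * cK * S * (geomT D).len (blkOf D.toDomains z) ^ 2 := by ring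
  -- step 2: `|Q′G′f(y)| ≤ C·c·S·(Lʲ)²`
  have hv : ∀ y : ↥(bset D.toDomains), |QB D.toDomains (gmlT (N0 ℓ Mh k P) ℓ k D.lev a *ᵥ f) y| ≤ C * cK * S * (geomT D).len y ^ 2 := by
    intro y
    refine B8Ineq192MultiLevelBox.abs_QB_le (D := D.toDomains) _ (by positivity) y fun z hz => ?_
    rw [← hz]
    exact hGf z
  -- step 3: `|G(Q′G′f)(y)| ≤ C₁·C·L²·c²·S·(Lʲ)⁻²` ((2.87), the weight `(L^{j′})²` moved by (2.60), summed by (2.61))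
  have hmat : ∀ y y' : ↥(bset D.toDomains), |mat G y y'| ≤
      C₁ * ((geomT D).len y ^ 4)⁻¹ * Real.exp (-(δ₁ / 2 * (geomT D).dist y y')) := by
    intro y y'
    have h := hG y y'
    have hWpos := W_pos D.toDomains y'
    have hW : W D.toDomains y' = (geomT D).len y' ^ (d + 1) := W_eq_lenT_pow D y'
    rw [abs_div, abs_of_pos hWpos, div_le_iff₀ hWpos, rpow_neg_four_eq (lenT_pos D y),
      rpow_neg_natCast_eq (lenT_pos D y'), hW] at h
    calc |mat G y y'| ≤ _ := h
      _ = C₁ * ((geomT D).len y ^ 4)⁻¹ * Real.exp (-(δ₁ / 2 * (geomT D).dist y y')) *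
            (((geomT D).len y' ^ (d + 1))⁻¹ * (geomT D).len y' ^ (d + 1)) := by ring
      _ = C₁ * ((geomT D).len y ^ 4)⁻¹ * Real.exp (-(δ₁ / 2 * (geomT D).dist y y')) := by
            rw [inv_mul_cancel₀ (pow_pos (lenT_pos D y') _).ne', mul_one]
  have hf2 : ∀ y y'' : (geomT D).Site, (geomT D).len y'' ^ 2 ≤
      ((ℓ : ℝ) + 1) ^ 2 * Real.exp (δ₁ / 4 * (geomT D).dist y y'') * (geomT D).len y ^ 2 :=
    fun y y'' => pow_lenT_le hMh1 hP hRMone 2 (by positivity) (hthr (δ₁ / 4) hσδ₁) y y''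
  have hGv : ∀ y : ↥(bset D.toDomains), |G (QB D.toDomains (gmlT (N0 ℓ Mh k P) ℓ k D.lev a *ᵥ f)) y| ≤
      C₁ * C * ((ℓ : ℝ) + 1) ^ 2 * cK ^ 2 * S * ((geomT D).len y ^ 2)⁻¹ := by
    intro y
    have hn : 0 ≤ C₁ * ((geomT D).len y ^ 4)⁻¹ := mul_nonneg hC₁.le (inv_nonneg.2 (pow_nonneg (hlen0 y) 4))
    have h2 := levelRowSum_le (g := geomT D) hdnn (σ := δ₁ / 2) (β := δ₁ / 4) (τ := δ₁ / 4)
      (A := ((ℓ : ℝ) + 1) ^ 2) (c := cK) (by linarith) (by positivity) (f := fun b => (geomT D).len b ^ 2)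
      (fun b => pow_nonneg (hlen0 b) 2) hf2 (hrow (δ₁ / 4) hσδ₁) y
    have h2' : ∑ y' : ↥(bset D.toDomains), Real.exp (-(δ₁ / 2 * (geomT D).dist y y')) * (geomT D).len y' ^ 2 ≤
        ((ℓ : ℝ) + 1) ^ 2 * cK * (geomT D).len y ^ 2 := h2
    rw [apply_eq_sum_mat]
    have hly : 0 < (geomT D).len y := lenT_pos D y
    calc |∑ y' : ↥(bset D.toDomains), mat G y y' * QB D.toDomains (gmlT (N0 ℓ Mh k P) ℓ k D.lev a *ᵥ f) y'|
        ≤ ∑ y' : ↥(bset D.toDomains), |mat G y y' * QB D.toDomains (gmlT (N0 ℓ Mh k P) ℓ k D.lev a *ᵥ f) y'| :=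
          Finset.abs_sum_le_sum_abs _ _
      _ ≤ ∑ y' : ↥(bset D.toDomains), C₁ * ((geomT D).len y ^ 4)⁻¹ * Real.exp (-(δ₁ / 2 * (geomT D).dist y y')) *
            (C * cK * S * (geomT D).len y' ^ 2) := Finset.sum_le_sum fun y' _ => by
          rw [abs_mul]
          exact mul_le_mul (hmat y y') (hv y') (abs_nonneg _) (mul_nonneg hn (Real.exp_nonneg _))
      _ = C₁ * ((geomT D).len y ^ 4)⁻¹ * (C * cK * S) *
            ∑ y' : ↥(bset D.toDomains), Real.exp (-(δ₁ / 2 * (geomT D).dist y y')) * (geomT D).len y' ^ 2 := by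
          rw [Finset.mul_sum]
          exact Finset.sum_congr rfl fun y' _ => by ring
      _ ≤ C₁ * ((geomT D).len y ^ 4)⁻¹ * (C * cK * S) * (((ℓ : ℝ) + 1) ^ 2 * cK * (geomT D).len y ^ 2) :=
          mul_le_mul_of_nonneg_left h2' (mul_nonneg hn (by positivity))
      _ = C₁ * C * ((ℓ : ℝ) + 1) ^ 2 * cK ^ 2 * S * ((geomT D).len y ^ 2)⁻¹ := by
          field_simp
  -- step 4: `|G′Q′*(…)(x)| ≤ C₁·C²·L⁴·c³·S` (Prop. 2.2, the weight `(L^{j′})⁻²` moved by (2.60), summed by (2.61))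
  have hu : ∀ z : ↥(boxDom (N0 ℓ Mh k P)),
      |QsB D.toDomains (G (QB D.toDomains (gmlT (N0 ℓ Mh k P) ℓ k D.lev a *ᵥ f))) z| ≤
        C₁ * C * ((ℓ : ℝ) + 1) ^ 2 * cK ^ 2 * S * ((geomT D).len (blkOf D.toDomains z) ^ 2)⁻¹ :=
    fun z => by rw [QsB_apply]; exact hGv _
  have hfi2 : ∀ y y'' : (geomT D).Site, ((geomT D).len y'' ^ 2)⁻¹ ≤
      ((ℓ : ℝ) + 1) ^ 2 * Real.exp (δ₀ / 4 * (geomT D).dist y y'') * ((geomT D).len y ^ 2)⁻¹ :=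
    fun y y'' => inv_pow_lenT_le hMh1 hP hRMone 2 (by positivity) (hthr (δ₀ / 4) hσδ₀) y y''
  have hA : 0 ≤ C₁ * C * ((ℓ : ℝ) + 1) ^ 2 * cK ^ 2 * S := by positivity
  have hlast : |(gmlT (N0 ℓ Mh k P) ℓ k D.lev a *ᵥ QsB D.toDomains (G (QB D.toDomains (gmlT (N0 ℓ Mh k P) ℓ k D.lev a *ᵥ f)))) x|
      ≤ B * S := by
    have h1 := abs_apply_le_of_levelBound (g := geomT D) (blkOf D.toDomains) hTG' (p := fun b => ((geomT D).len b ^ 2)⁻¹) hA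
      (fun b => inv_nonneg.2 (pow_nonneg (hlen0 b) 2)) hu x
    rw [Matrix.toLin'_apply] at h1
    refine h1.trans ?_
    have h2 := levelRowSum_le (g := geomT D) hdnn (σ := δ₀ / 2) (β := δ₀ / 4) (τ := δ₀ / 4)
      (A := ((ℓ : ℝ) + 1) ^ 2) (c := cK) (by linarith) (by positivity) (f := fun b => ((geomT D).len b ^ 2)⁻¹)
      (fun b => inv_nonneg.2 (pow_nonneg (hlen0 b) 2)) hfi2 (hrow (δ₀ / 4) hσδ₀) (blkOf D.toDomains x)
    have hsum : ∑ b' : (geomT D).Site, C * (geomT D).len (blkOf D.toDomains x) ^ 2 *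
          Real.exp (-(δ₀ / 2 * (geomT D).dist (blkOf D.toDomains x) b')) * ((geomT D).len b' ^ 2)⁻¹
        = C * (geomT D).len (blkOf D.toDomains x) ^ 2 * ∑ b' : (geomT D).Site,
            Real.exp (-(δ₀ / 2 * (geomT D).dist (blkOf D.toDomains x) b')) * ((geomT D).len b' ^ 2)⁻¹ := by
      rw [Finset.mul_sum]
      exact Finset.sum_congr rfl fun b' _ => by ring
    rw [hsum]
    have hq : 0 ≤ C * (geomT D).len (blkOf D.toDomains x) ^ 2 := mul_nonneg hC.le (pow_nonneg (hlen0 _) 2)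
    have hlx : 0 < (geomT D).len (blkOf D.toDomains x) := lenT_pos D _
    calc C₁ * C * ((ℓ : ℝ) + 1) ^ 2 * cK ^ 2 * S * (C * (geomT D).len (blkOf D.toDomains x) ^ 2 *
          ∑ b' : (geomT D).Site, Real.exp (-(δ₀ / 2 * (geomT D).dist (blkOf D.toDomains x) b')) * ((geomT D).len b' ^ 2)⁻¹)
        ≤ C₁ * C * ((ℓ : ℝ) + 1) ^ 2 * cK ^ 2 * S * (C * (geomT D).len (blkOf D.toDomains x) ^ 2 *
          (((ℓ : ℝ) + 1) ^ 2 * cK * ((geomT D).len (blkOf D.toDomains x) ^ 2)⁻¹)) :=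
          mul_le_mul_of_nonneg_left (mul_le_mul_of_nonneg_left h2 hq) hA
      _ = B * S := by
          rw [hB]
          field_simp
  -- `Rf = f − G′Q′*G Q′G′f`
  rw [rProjMLT_apply, Pi.sub_apply]
  calc |f x - _| ≤ |f x| + |(gmlT (N0 ℓ Mh k P) ℓ k D.lev a *ᵥ
        QsB D.toDomains (G (QB D.toDomains (gmlT (N0 ℓ Mh k P) ℓ k D.lev a *ᵥ f)))) x| := abs_sub _ _
    _ ≤ S + B * S := add_le_add (hf x) hlast
    _ = (B + 1) * S := by ring

end RProj

end

end Literature.MathematicalPhysics.QuantumFieldTheory.Balaban1983to89.B8Ineq192MultiLevelTorus
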